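import Literature.Analysis.FluidPDE.SlipCylinderClassicalNS
import Literature.Analysis.FluidPDE.Ferrari1993LogEstimateReduction
import Literature.Analysis.FluidPDE.SwirlMaximumPrinciple
import Literature.Analysis.FluidPDE.KNSSSwirlTransport
import HarnessLib

/-!
# C179 `Zajaczkowski2023` — W. M. Zajączkowski, «Global regular axially-symmetric solutions to the
# Navier-Stokes equations. Part 1», arXiv:2304.00856v1 (math.AP, 2023-04-03, ONE version, 47 pp.)
# [Zajaczkowski2023] — typed skeleton (D-0090 NS-CLAIMS SWEEP; LADDER row, rung 2: axisymmetric WITH swirl)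

Cell `ns-claims`, claim C179 (B26 PROMOTED; RULINGS v1.51 (3), lead-1 g7 2026-08-27T18:41:05Z). Typist
ns-claims-typist-4 g7. Text of record: `sources/Zajaczkowski2023/arXiv-2304.00856v1.pdf` sha16 407afe8b5bf09cda,
47 pp., **PDF page = printed page**; line spans `pages/pNNN.txt` are those of lit-3 g10's `LOCATORS.md`; TeX from
the held chunks `paper:arxiv-2304.00856`. Lineage: #112 C130 `Zajaczkowski2018` is a DIFFERENT text (periodic box,
weakly compressible auxiliary system) — vocabulary not shared. NOT a Clay claim as printed (no Clay / Millennium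
sentence in the 47 pp.): the row's CLAIMED is the a-priori bound (1.24) in its own setting; the Δ-ledger against
Fefferman's (A)/(B) is RECORDED only (Δ1 bounded cylinder, Δ3 boundary conditions, Δ4 data norms D₁…D₁₀, Δ6 force).

## What the text asserts (verbatim)

* Setting p.1 l.26 – p.3: the bounded cylinder `Ω = {x ∈ ℝ³ : x₁² + x₂² < R², |x₃| < a}`, lateral boundary `S₁`
  (`r = R`), top/bottom `S₂(±a)`; axially-symmetric fields (1.3)–(1.5) `v = v_r(r,z,t)ē_r + v_φ ē_φ + v_z ē_z`;
  problem **(1.6)** p.2 l.38–49: «v,_t + v·∇v − νΔv + ∇p = f in Ω^T, div v = 0 in Ω^T, v satisfies periodic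
  boundary conditions on S₂^T, v·n̄|_{S₁} = 0, ω_φ|_{S₁} = 0, v_φ|_{S₁} = 0 on S₁^T, v|_{t=0} = v(0) in Ω»;
  swirl `u = r v_φ` (1.11); `(Φ, Γ) = (ω_r/r, ω_φ/r)` (1.16) p.4 l.52; stream function `ψ` (1.13)–(1.15) and
  `ψ₁ = ψ/r` with **(1.21)** p.5 l.3–6 «v_r = −rψ_{1,z}, v_z = (rψ₁),_r + ψ₁ = rψ_{1,r} + 2ψ₁, …» (so
  `v_z|_{r=0} = 2ψ₁|_{r=0}`) and **(1.22)** p.5 l.10–17 «−Δψ₁ − (2/r)ψ_{1,r} = ω₁ in Ω, ψ₁|_{r=R} = 0, periodic on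
  S₂», (1.23) `ω₁ = ω_φ/r = Γ`.
* **Assumption 1.1** p.5 l.21 – p.6 l.24: «Assume that the following quantities are finite: D₁ = ‖f‖_{L₂(Ω^t)} +
  ‖v(0)‖_{L₂(Ω)}, D₂ = ‖f₀‖_{L_{∞,1}(Ω^t)} + ‖u(0)‖_{L_∞(Ω)}, f₀ = rf_φ, u = rv_φ, D₃² = D₁²D₂² + ‖u,_z(0)‖²_{L₂(Ω)}
  + ‖f₀‖²_{L₂(Ω^t)}, D₄² = D₁²(1 + D₂) + ‖u,_r(0)‖²_{L₂(Ω)} + ‖f₀‖²_{L₂(Ω^t)} + ‖f₀‖_{L₂(0,t;L_{4/3}(S₁))} …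
  D₅ = D₂(D₁ + D₂ + D₃), D₆ = D₂^{1−ε₀}D₃, where ε₀ is arbitrary small positive number. Moreover D₇ = ‖F_r‖² + ‖F_z‖²
  (L₂(0,t;L_{6/5}(Ω))) + ‖ω_r(0)‖² + ‖ω_z(0)‖² (L₂(Ω)) … D₈ = φ(D₂)(‖F̄_r‖² + ‖F̄_φ‖²) + ‖Φ(0)‖² + ‖Γ(0)‖² …
  D₉(12) = 12‖f_φ‖_{L_{12}(0,t;L_{36/25}(Ω))} + ‖v_φ(0)‖_{L_{12}(Ω)} … D₁₀ = ‖f_φ/r‖_{L₁(0,t;L_∞(Ω))} +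
  ‖v_φ(0)‖_{L_∞(Ω)}» (`F = rot f`, `F̄ = F/r`).
* **Theorem 1.2 («The main result») p.6 l.25–28 = CLAIMED**: «Assume that Assumption 1.1 holds. Then there exists
  an increasing positive function φ such that ‖Φ‖_{V(Ω^t)} + ‖Γ‖_{V(Ω^t)} ≤ φ(D₁, ⋯, D₁₀). (1.24)», with
  «‖u‖_{V(Ω^t)} = |u|_{2,∞,Ω^t} + |∇u|_{2,Ω^t}» (Def 2.1 p.7 l.32–34). **Remark 1.3** p.6 l.29–30: «Estimate (1.24)
  implies any regularity of solutions to problem (1.6) assuming sufficient regularity of data.» (RECORDED; no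
  regularity theorem is stated or proved in the text).
* **p.6 l.31**: «To prove (1.24) we need that ψ₁ and v_z vanish on the axis of symmetry.» Abstract p.1 l.19–21:
  «To prove this we need that the coordinate of velocity along the axis of symmetry must vanish on it.»
* Proof plan p.6 l.32 – p.7 l.10, items 1–5: 1. Lemmas 2.2/2.3 (energy (2.1) ≡ D₁², `L_∞` bound (2.7) for the swirl
  ≡ D₂); 2. Lemma 2.5: weak solutions `ψ₁ ∈ H¹(Ω)` of (1.22), «The weak solutions to (1.22) proved in Lemma 2.5 do
  not vanish on the axis of symmetry» (also Remark 2.6 p.10 l.64–65); **3. (p.6 l.40–43) «In Section 3 for a given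
  ω₁ ∈ H¹(Ω) many estimates for ψ₁ are found. In Lemma 3.3 we derived such estimate that ψ₁ must vanish on the
  axis of symmetry. We need the estimate in the proof of (1.24). The result of Lemma 3.3 shows that weak solutions
  proved in Lemma 2.5 must vanish on the axis of symmetry. In view of properties of the stream function it means
  that v_z also vanishes on the axis of symmetry.»**; 4. §4: estimate of `X = ‖Φ‖_V + ‖Γ‖_V` by
  `|v_φ|_{12,∞,Ω^t}` and `|v_φ|^{ε₀}_{∞,Ω^t}` ((4.43), Remark 4.6 p.29); 5. Lemma 4.7 (4.44) bounds
  `|v_φ|_{∞,Ω^t}`; **Remark 4.8 p.33 l.42**: «Inequalities (4.43) and (4.44) imply (4.46) X ≤ φ(D₂,D₅,D₇,D₈,D₉,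
  |f_φ/r|_{∞,1,Ω^t}, |v_φ(0)|_{∞,Ω}). The above inequality proves Theorem 1.2.»
* **Lemma 3.3 p.17 l.26–57**: «Let ψ₁ be such weak solution to problem (3.1) that it vanishes on the axis of
  symmetry. Then such sufficiently regular solutions to problem (3.1) satisfy the estimate
  (3.25) ∫_Ω ψ²_{1,zz}/r² dx + ∫_Ω (ψ²_{1,zrr} + ψ²_{1,zr}/r² + ψ²_{1,z}/r⁴) dx ≤ c|ω_{1,z}|²_{2,Ω}.» ((3.1) p.11 =
  (1.22) written out: «−ψ_{1,rr} − ψ_{1,zz} − (3/r)ψ_{1,r} = ω₁»; (3.27) «Applying Lemma 3.1 from [NZ]» =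
  arXiv:2210.15729.) **Remark 3.4 p.18 l.53–55**: «Lemma 3.3 is necessary in the proof of global regular
  axially-symmetric solutions to problem (1.6). However, it imposes strong restrictions on solutions to (1.6) because
  the condition ψ₁|_{r=0} = 0 implies that v_z|_{r=0} = 0. We do not know how to omit the restriction in the
  presented proof in this paper.» USES of (3.25) downstream: proof of Lemma 4.1, p.23 l.116–118 «≤ cD₂|Γ,_z|_{2,Ω}
  |Φ,_r|_{2,Ω}, where (3.25) is used» ((4.6)); proof of Lemma 6.1, p.43 l.117–119 «Estimates (3.22) and (3.25) imply
  (6.5)» — both upstream of Remark 4.8.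

## How it is typed (grain; cite-never-restate: tree vocabulary `Literature.Analysis.FluidPDE.*`)

The cylinder, the cylindrical frame and components (`cylRadius`, `eR`, `eTheta`, `eZ`, `radialVelocity`,
`swirlVelocity`, `axialVelocity`, `swirl = r v_φ`), axisymmetry (`IsAxisymmetric`, `IsAxisymmetricScalar`),
axial periodicity (`IsAxiallyPeriodic`), the vorticity `curl` and the forced classical Navier–Stokes system in a
container (`IsClassicalNSOnDomain S Ω ν f v p`: `C^∞` up to the wall on `S × closure Ω`, momentum + `div v = 0` at
interior points) are the TREE's (AxisymmetricEuler / SlipCylinderClassicalNS / VectorCalculus); only the radius-`R`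
cylinder `cylinder R`, the period cell `cell R a` and the norms below are spelled out here.
* SETTING = `IsSolution R a ν T f v p ψ₁` (l.227): (1.6)₁,₂ via `IsClassicalNSOnDomain (Ico 0 T) (cylinder R) ν f v p`;
  «sufficiently regular» (Lemmas 3.1–3.3, 3.5) typed as `C^∞` of `v, p, f, ψ₁` on all of `ℝ × ℝ³` (a SUB-class of
  the printed one — charitable for the CLAIM, immaterial for the located sentence); axisymmetry (1.3)–(1.5) of
  `v, f, p, ψ₁`; `2a`-periodicity in `x₃` (1.6)₃; the wall conditions (1.6)₄ `v_r = v_φ = ω_φ = 0` on `r = R` and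
  (1.22)₂ `ψ₁|_{r=R} = 0`; and — ANSWER to refuter-2 g9's ask (c) — the stream-function representation is part of
  the SETTING, not a Step: `ψ₁` is a field of the structure tied to `v` by the printed identities (1.21)
  `v_r = −rψ_{1,z}`, `v_z = rψ_{1,r} + 2ψ₁` on `closure Ω` and by (1.22)₁ with `ω₁ = Γ` off the axis (kinematics of
  axisymmetric solenoidal fields, [LW]; TRUE-type, so carrying them as hypotheses restricts nothing). The datum is
  `v 0` ((1.6)₅). `D₁ … D₁₀` are CONCRETE `ℝ≥0∞`-valued functionals of `(f, v 0)` on `Ω^t` (`dataVec`, l.313;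
  `∫⁻`/`eLpNorm`/`essSup` throughout, so a divergent norm is `⊤`, never Bochner-junk — ask (d)); Assumption 1.1 =
  `∀ i, dataVec … i < ⊤`. Print variants recorded, not resolved: Lemma 2.2's own «D₁² ≡ 3‖f‖²_{L_{2,1}} + 2‖v(0)‖²»
  vs Assumption 1.1's D₁; D₅/D₇ variants of Lemma 6.1 p.38; D₈'s factor «φ(D₂)» (an unspecified increasing function)
  is dropped from `D 7` — any increasing φ of the printed D₈ is an increasing function of (D₂, our D₈) and
  conversely, so (1.24) is unchanged; `ε₀ ∈ (0,1)` (D₆) is a parameter of `dataVec` and of the claim.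
* `ClaimedTheorem` (l.333) = (1.24) BY NAME with the printed quantifier order (ask (d)): for every `R, a, ν, ε₀`
  THERE IS ONE increasing (`Monotone` for the product order on `Fin 10 → ℝ`) positive `φ` such that EVERY solution of
  the setting with Assumption 1.1 on `Ω^t`, `0 < t ≤ T`, has `X(t) = ‖Φ‖_{V(Ω^t)} + ‖Γ‖_{V(Ω^t)} ≤ φ(D₁,…,D₁₀)`.
* Steps (print order of the plan p.6–7; binders of `claim_of_steps`, ALL CONSUMED):
  1 `Step1_L22_L23` — Lemma 2.2 (2.1) p.8 + Lemma 2.3 (2.7) p.9 along every solution (TRUE-type: energy identity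
    with these wall conditions, maximum principle for `u = rv_φ`; classical).
  3 **`Step3_PlanItem3`** — the print's own sentence p.6 l.40–43 («for a given ω₁ ∈ H¹(Ω) … ψ₁ must vanish on the
    axis of symmetry … weak solutions proved in Lemma 2.5 must vanish on the axis of symmetry»), FUNCTION grain on
    the elliptic problem (1.22)/(3.1), POINTWISE over concrete scalar fields on `ℝ³` (asks (a)/(b)): every `C^∞`
    axisymmetric `2a`-periodic `ψ₁` with `ψ₁|_{r=R} = 0` (its `ω₁ := −Δψ₁ − (2/r)ψ_{1,r}` is then `C^∞(Ω̄) ⊂ H¹(Ω)`,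
    and `ψ₁` is the weak solution of (1.22) for that `ω₁` — the typed sentence is IMPLIED BY the printed one)
    vanishes on the axis `{r = 0}`. This is the print's self-named load-bearing point (p.6 l.31, abstract l.19–21,
    Remark 3.4; flagged for refuter-2 g9 / ref-3 g8 as asked on the TAKING thread). Its solution-grain form
    `Step3_AxisVanishing` («ψ₁ and v_z vanish on the axis of symmetry» for the flows of the setting) is DERIVED:
    `step3Axis_of_planItem3` PROVED from (1.21) (`v_z|_{r=0} = 2ψ₁|_{r=0}`).
  3′ `Step_L33` — Lemma 3.3 (3.25) AS PRINTED, WITH its hypothesis «ψ₁ vanishes on the axis of symmetry» (function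
    grain, `∫⁻`; TRUE-type per [NZ] Lemma 3.1 — the discharge of its hypothesis is the visible Step 3, ask (a) /
    ref-2 g8 W1, W3).
  4 `Step4_Sec4` — §4 through Remark 4.6: along a solution, FROM (2.1)/(2.7) (item 1) and (3.25) for the solution's
    `ψ₁(τ)` at every time (item 3′ — this is where p.23 l.118 and p.43 l.119 consume Lemma 3.3), the bound (4.43)
    p.29 «X² ≤ c(1 + |v_φ|^{2ε₀}_{∞,Ω^t})|v_φ|^{κε₀}_{∞,Ω^t} + φ(D₅,D₇,D₈,D₉)» (printed `κ = 96ε/(ε₁ − 11ε₂)`; typed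
    `∃ c, κ > 0` and an increasing `φ₄` of all ten `D`'s — weaker than print).
  5 `Step5_L47` — Lemma 4.7 (4.44) p.29: `|v_φ|_{∞,Ω^t} ≤ φ₇(D₂,D₅,D₇,D₈,D₉,D₁₀)` along solutions whose `ψ₁`
    vanishes on the axis (the class §4 works in).
  6 `Step6_R48` — Remark 4.8 p.33 l.42, the closing algebra «(4.43) and (4.44) imply (4.46) … proves Theorem 1.2»
    (TRUE-type real analysis: `X² ≤ c(1+M^{2ε₀})M^{κε₀} + φ₄`, `M ≤ φ₇` ⇒ `X ≤ φ`).
  `claim_of_steps : Step1 → Step3_PlanItem3 → Step_L33 → Step4 → Step5 → Step6 → ClaimedTheorem` — PROVED; and the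
  charitable reading `claimAxis_of_steps : Step1 → Step_L33 → Step4 → Step5 → Step6 → ClaimedTheoremAxis` — PROVED —
  where `ClaimedTheoremAxis` is (1.24) restricted to the solutions with `ψ₁|_{r=0} = 0` (equivalently
  `v_z|_{r=0} = 0`), the class Remark 3.4 says the presented proof cannot leave.
* Not typed (docstrings only): Lemma 2.4 (2.10), Lemma 2.5/(2.11) and Remark 2.6 (existence/non-vanishing of the weak
  solution — superseded in the setting by the field `ψ₁`), Lemmas 3.1/3.2/3.5, 4.1–4.3/4.5, Remarks 4.4/4.6 (folded
  in Step 4), §5 Lemma 5.1 (D₃, D₄) and §6 Lemma 6.1 (D₇; second use of (3.25)) — interior to items 4–5; the [LW]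
  near-axis expansions used to drop axis boundary terms (p.23 l.13–22, p.36, p.41) — TRUE-type for smooth
  axisymmetric fields. No `ClayDelta` binder (LADDER row; lit-4 g9 words the Clay cell).

## Rev 3 (typist-4 g8, 2026-08-27): Step 1 (Lemmas 2.2 / 2.3) is TRUE — `step1_L22_L23_holds`

§I below PROVES `Step1_L22_L23` (theorems only; no new named facts, no new definitions): (2.1) by the energy
method on the period cell — the tree's Cartesian Gauss–Green identity on the unit period cell
(`Literature.Analysis.FluidPDE.setIntegral_divergence_periodCell_eq_zero`, PeriodicCylinderGaussGreen) transported
to `Ω = {r < R} × (−a, a)` by the chart `y ↦ R y − a e_z`, applied to the pressure flux `2p v`, the transport flux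
`|v|² v` and the viscous flux `∇(½|v|²)` (all tangential on the wall: `v_r = 0`; `v_φ = 0` and `ω_φ = 0` give
`∂_r v_z = 0`), differentiation of `∫_Ω |v|²` under the integral sign, and the `√`-Grönwall step
`‖v(σ)‖₂ ≤ ‖v(0)‖₂ + ∫₀^σ ‖f‖₂` that yields the printed constants `3` and `2`; (2.7) by the tree's weak parabolic
maximum principle (`Literature.Analysis.FluidPDE.weak_max_principle`, SwirlMaximumPrinciple) applied to
`±rv_φ − (‖rv_φ(0)‖_∞ + ∫₀ᵗ max|rf_φ| + εe^{βt}(1 + z²))` on `{r ≤ R, |z| ≤ Z}` (the swirl equation at interior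
off-axis points from `momentum` paired with the rotation generator; `u = 0` on the axis and on the wall; periodicity
in `z` bounds `u` so the barrier wins at `|z| = Z`; `ε → 0`). Compositions with `h1` discharged:
`claim_of_steps''`, `claimAxis_of_steps''`.

WHAT THIS IS NOT: not a claim about NS regularity or blow-up; not a claim about any author beyond the typed
locator.
-/

noncomputable section

open Set Function MeasureTheory WithLp
open scoped ContDiff ENNReal Laplacian InnerProductSpace RealInnerProductSpace

namespace Literature.Claims.NS.Zajaczkowski2023

open Literature.Analysis.FluidPDE

/-! ## §A. Geometry of the cylinder and cylindrical calculus (tree frame `eR`, `eTheta`, `eZ`) -/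

/-- `ℝ³`. [cite: Zajaczkowski2023, §1 p.1 l.28] -/
abbrev E3 : Type := EuclideanSpace ℝ (Fin 3)

/-- The point with cylindrical coordinates `(r, φ = 0, z)`, i.e. `(r, 0, z)`. [cite: Zajaczkowski2023, (1.1) p.2 l.24] -/
def pt (r z : ℝ) : E3 := toLp 2 ![r, 0, z]

/-- A point of the axis of symmetry `{x₁ = x₂ = 0}`: `(0, 0, z)`. [cite: Zajaczkowski2023, §1 p.1 l.30 («the x₃-axis is the axis of symmetry»)] -/
def axisPt (z : ℝ) : E3 := pt 0 z

/-- The open cylinder `{x : x₁² + x₂² < R²} = {r < R}` of radius `R` about the axis (the radius-`R` twin of the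
tree's `unitCylinder`). [cite: Zajaczkowski2023, §1 p.1 l.28 (Ω)] -/
def cylinder (R : ℝ) : TopologicalSpace.Opens E3 :=
  ⟨{x | cylRadius x < R}, isOpen_lt continuous_cylRadius continuous_const⟩

/-- One period cell `Ω = {r < R, |x₃| < a}` of the `2a`-periodic cylinder — the printed domain.
[cite: Zajaczkowski2023, §1 p.1 l.28] -/
def cell (R a : ℝ) : Set E3 := {x | cylRadius x < R ∧ x 2 ∈ Ioo (-a) a}

/-- Lebesgue measure restricted to the cell `Ω`. [folklore] -/
def μΩ (R a : ℝ) : Measure E3 := volume.restrict (cell R a)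

/-- Radial derivative `g,_r (x) = Dg(x)[e_r]` of a scalar field (junk `0` on the axis, where `eR = 0`).
[cite: Zajaczkowski2023, (1.8) p.3] -/
def dR (g : E3 → ℝ) (x : E3) : ℝ := fderiv ℝ g x (eR x)

/-- Axial derivative `g,_z (x) = Dg(x)[e_z]`. [cite: Zajaczkowski2023, (1.8) p.3] -/
def dZ (g : E3 → ℝ) (x : E3) : ℝ := fderiv ℝ g x eZ

/-- `Φ = ω_r / r` along a velocity `v` (time `t`, point `x`), `ω = curl v` (junk `0` on the axis).
[cite: Zajaczkowski2023, (1.16) p.4 l.52] -/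
def PhiOf (v : ℝ → E3 → E3) (t : ℝ) (x : E3) : ℝ := radialVelocity (curl (v t)) x / cylRadius x

/-- `Γ = ω_φ / r = ω₁` along a velocity `v`. [cite: Zajaczkowski2023, (1.16) p.4 l.52; (1.23) p.5 l.19] -/
def GammaOf (v : ℝ → E3 → E3) (t : ℝ) (x : E3) : ℝ := swirlVelocity (curl (v t)) x / cylRadius x

/-- The operator of (1.22)/(3.1) applied to a scalar `ψ₁`: `ω₁ := −Δψ₁ − (2/r)ψ_{1,r}` (3D Laplacian of an
axisymmetric scalar `= ψ_{1,rr} + ψ_{1,r}/r + ψ_{1,zz}`, so this is (3.1) «−ψ_{1,rr} − ψ_{1,zz} − (3/r)ψ_{1,r}»).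
[cite: Zajaczkowski2023, (1.22) p.5 l.10–17; (3.1) p.11 l.97–104] -/
def omega1Of (ψ₁ : E3 → ℝ) (x : E3) : ℝ := -(Δ ψ₁) x - 2 / cylRadius x * dR ψ₁ x

/-- **«ψ₁ is a (sufficiently regular) solution of (3.1) = (1.22) with datum ω₁»**, POINTWISE over concrete scalar
fields on `ℝ³` (refuter-2 g9 ask (b)): `ψ₁, ω₁` are `C^∞`, axially symmetric, `2a`-periodic in `x₃`, `ψ₁|_{r=R} = 0`,
and `−Δψ₁ − (2/r)ψ_{1,r} = ω₁` at every point of the open cylinder off the axis (so `ω₁ ∈ C^∞(Ω̄) ⊂ H¹(Ω)` and `ψ₁`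
is the weak solution of Lemma 2.5 for this `ω₁`). [cite: Zajaczkowski2023, (1.22) p.5 l.10–17; (3.1) p.11 l.97–104; Lemma 2.5 p.10 l.43–47] -/
def SolvesStream (R a : ℝ) (ψ₁ ω₁ : E3 → ℝ) : Prop :=
  ContDiff ℝ ∞ ψ₁ ∧ ContDiff ℝ ∞ ω₁ ∧ IsAxisymmetricScalar ψ₁ ∧ IsAxisymmetricScalar ω₁ ∧
    IsAxiallyPeriodic (2 * a) ψ₁ ∧ IsAxiallyPeriodic (2 * a) ω₁ ∧ (∀ x : E3, cylRadius x = R → ψ₁ x = 0) ∧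
      ∀ x ∈ cylinder R, cylRadius x ≠ 0 → omega1Of ψ₁ x = ω₁ x

/-! ## §B. Norms on `Ω`, `Ω^t`, `S₁^t` (Definition 2.1 p.7; all `ℝ≥0∞`-valued) -/

/-- `|g|_{q,Ω}` (Def 2.1 p.7 l.18–24), `q ∈ [1, ∞]`. [cite: Zajaczkowski2023, Def 2.1 p.7 l.18–24] -/
def Lp (R a : ℝ) (q : ℝ≥0∞) (g : E3 → ℝ) : ℝ≥0∞ := eLpNorm g q (μΩ R a)

/-- `|G|_{p,q,Ω^t} = ‖G‖_{L_q(0,t;L_p(Ω))}` for finite `q` (Def 2.1 p.7 l.22–24).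
[cite: Zajaczkowski2023, Def 2.1 p.7 l.22–24] -/
def Lpq (R a : ℝ) (p : ℝ≥0∞) (q : ℝ) (t : ℝ) (G : ℝ → E3 → ℝ) : ℝ≥0∞ :=
  (∫⁻ τ in Ioo 0 t, Lp R a p (G τ) ^ q) ^ (1 / q)

/-- `|G|_{∞,Ω^t}` (essential supremum over `Ω × (0,t)`). [cite: Zajaczkowski2023, Def 2.1 p.7 l.18–24] -/
def LinfST (R a t : ℝ) (G : ℝ → E3 → ℝ) : ℝ≥0∞ :=
  eLpNorm (uncurry G) ∞ (volume.restrict (Ioo 0 t ×ˢ cell R a))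

/-- `‖g‖_{L_{4/3}(S₁)}` for an axisymmetric scalar on the lateral wall `S₁ = {r = R, |z| < a}`
(surface measure `R dφ dz`, the `φ`-integral contributing `2π`). [cite: Zajaczkowski2023, Assumption 1.1 p.5 (D₄); §1 p.2 l.1–10 (S₁)] -/
def wallL43 (R a : ℝ) (g : E3 → ℝ) : ℝ≥0∞ :=
  (ENNReal.ofReal (2 * Real.pi * R) * ∫⁻ z in Ioo (-a) a, ‖g (pt R z)‖ₑ ^ (4 / 3 : ℝ)) ^ (3 / 4 : ℝ)

/-- `‖G‖_{L₂(0,t;L_{4/3}(S₁))}`. [cite: Zajaczkowski2023, Assumption 1.1 p.5 (D₄)] -/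
def wallL43L2 (R a t : ℝ) (G : ℝ → E3 → ℝ) : ℝ≥0∞ :=
  (∫⁻ τ in Ioo 0 t, wallL43 R a (G τ) ^ (2 : ℝ)) ^ (1 / 2 : ℝ)

/-- The energy-space norm `‖G‖_{V(Ω^t)} = |G|_{2,∞,Ω^t} + |∇G|_{2,Ω^t}` of a scalar on `Ω^t`
(`|∇G|² = ‖DG‖²` for a scalar). [cite: Zajaczkowski2023, Def 2.1 p.7 l.32–34] -/
def Vnorm (R a t : ℝ) (G : ℝ → E3 → ℝ) : ℝ≥0∞ :=
  essSup (fun τ => Lp R a 2 (G τ)) (volume.restrict (Ioo 0 t)) +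
    (∫⁻ τ in Ioo 0 t, ∫⁻ x in cell R a, ‖fderiv ℝ (G τ) x‖ₑ ^ 2) ^ (1 / 2 : ℝ)

/-- `X(t) = ‖Φ‖_{V(Ω^t)} + ‖Γ‖_{V(Ω^t)}` along a velocity `v`. [cite: Zajaczkowski2023, (1.24) p.6 l.27; (4.22) p.27 l.96–97] -/
def X (R a t : ℝ) (v : ℝ → E3 → E3) : ℝ≥0∞ := Vnorm R a t (PhiOf v) + Vnorm R a t (GammaOf v)

/-! ## §C. The setting: axially-symmetric solutions of (1.6) in the periodic cylinder, with the stream function `ψ₁` -/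

/-- **The printed class of solutions of (1.6)** on `Ω × [0,T)` together with its stream-function variable `ψ₁ = ψ/r`
((1.13)–(1.15), (1.21), (1.22)): the forced Navier–Stokes system classically in the cylinder `{r < R}` (tree
`IsClassicalNSOnDomain`, `C^∞` up to the wall), all fields `C^∞` on `ℝ × ℝ³` («sufficiently regular solutions»,
Lemmas 3.1–3.3 — typed as a sub-class), axially symmetric ((1.3)–(1.5), (1.10)), `2a`-periodic in `x₃` ((1.6)₃),
with the wall conditions (1.6)₄ `v·n̄ = v_φ = ω_φ = 0` on `S₁ = {r = R}` and (1.22)₂ `ψ₁|_{r=R} = 0`, and with the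
kinematic identities (1.21) `v_r = −rψ_{1,z}`, `v_z = rψ_{1,r} + 2ψ₁` on `closure Ω` and (1.22)₁ `−Δψ₁ − (2/r)ψ_{1,r}
= ω₁ = Γ` off the axis ([LW]; TRUE-type for axisymmetric solenoidal fields — part of the SETTING, so that the print's
sentences about «the solution's ψ₁» have a referent; they restrict nothing). The datum is `v 0` ((1.6)₅); `ν > 0`
((1.6) p.2 l.49). [cite: Zajaczkowski2023, (1.6) p.2 l.38–49; (1.21) p.5 l.3–6; (1.22) p.5 l.10–17; §3 p.11–12 («sufficiently regular solutions»)] -/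
structure IsSolution (R a ν T : ℝ) (f v : ℝ → E3 → E3) (p : ℝ → E3 → ℝ) (ψ₁ : ℝ → E3 → ℝ) : Prop where
  R_pos : 0 < R
  a_pos : 0 < a
  ν_pos : 0 < ν
  T_pos : 0 < T
  /-- (1.6)₁,₂: momentum and `div v = 0` classically in `{r < R} × [0,T)`, `C^∞` up to the wall. -/
  ns : IsClassicalNSOnDomain (Ico 0 T) (cylinder R) ν f v p
  /-- «sufficiently regular»: `v, p, f, ψ₁` are `C^∞` jointly in `(t,x)` on `ℝ × ℝ³`. -/
  smooth_v : ContDiff ℝ ∞ (uncurry v)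
  smooth_p : ContDiff ℝ ∞ (uncurry p)
  smooth_f : ContDiff ℝ ∞ (uncurry f)
  smooth_ψ : ContDiff ℝ ∞ (uncurry ψ₁)
  /-- (1.3)–(1.5), (1.10): axial symmetry of velocity, force, pressure and `ψ₁`. -/
  axisym : ∀ t, IsAxisymmetric (v t) ∧ IsAxisymmetric (f t) ∧ IsAxisymmetricScalar (p t) ∧
    IsAxisymmetricScalar (ψ₁ t)
  /-- (1.6)₃: `2a`-periodicity in `x₃` of velocity, pressure, force and `ψ₁`. -/
  periodic : ∀ t, IsAxiallyPeriodic (2 * a) (v t) ∧ IsAxiallyPeriodic (2 * a) (p t) ∧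
    IsAxiallyPeriodic (2 * a) (f t) ∧ IsAxiallyPeriodic (2 * a) (ψ₁ t)
  /-- (1.6)₄ on `S₁ = {r = R}`: `v·n̄ = v_r = 0`, `v_φ = 0`, `ω_φ = 0`; and (1.22)₂ `ψ₁|_{r=R} = 0`. -/
  wall : ∀ t ∈ Ico 0 T, ∀ x : E3, cylRadius x = R →
    radialVelocity (v t) x = 0 ∧ swirlVelocity (v t) x = 0 ∧ swirlVelocity (curl (v t)) x = 0 ∧ ψ₁ t x = 0
  /-- (1.21) on `closure Ω`: `v_r = −rψ_{1,z}` and `v_z = rψ_{1,r} + 2ψ₁` (so `v_z = 2ψ₁` on the axis). -/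
  stream : ∀ t ∈ Ico 0 T, ∀ x : E3, cylRadius x ≤ R →
    radialVelocity (v t) x = -(cylRadius x * dZ (ψ₁ t) x) ∧
      axialVelocity (v t) x = cylRadius x * dR (ψ₁ t) x + 2 * ψ₁ t x
  /-- (1.22)–(1.23): at every time `ψ₁(t)` solves (3.1) with a `C^∞` axisymmetric periodic datum `ω₁` that equals
  `Γ(t) = ω_φ/r` in `Ω` off the axis. -/
  stream_eq : ∀ t ∈ Ico 0 T, ∃ ω₁ : E3 → ℝ, SolvesStream R a (ψ₁ t) ω₁ ∧
    ∀ x ∈ cylinder R, cylRadius x ≠ 0 → ω₁ x = GammaOf v t x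

/-! ## §D. The data functionals `D₁ … D₁₀` (Assumption 1.1 p.5 l.21 – p.6 l.24) -/

section Data

variable (R a ε₀ t : ℝ) (f v : ℝ → E3 → E3)

/-- `D₁ = ‖f‖_{L₂(Ω^t)} + ‖v(0)‖_{L₂(Ω)}`. [cite: Zajaczkowski2023, Assumption 1.1 p.5 l.23] -/
def D1 : ℝ≥0∞ := Lpq R a 2 2 t (fun τ x => ‖f τ x‖) + Lp R a 2 (fun x => ‖v 0 x‖)

/-- `D₂ = ‖f₀‖_{L_{∞,1}(Ω^t)} + ‖u(0)‖_{L_∞(Ω)}`, `f₀ = rf_φ`, `u = rv_φ` (tree `swirl w = x₀w₁ − x₁w₀ = r w_φ`).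
[cite: Zajaczkowski2023, Assumption 1.1 p.5 l.25–27; (2.7) p.9 l.50–52] -/
def D2 : ℝ≥0∞ := Lpq R a ∞ 1 t (fun τ => swirl (f τ)) + Lp R a ∞ (swirl (v 0))

/-- `D₃`, from `D₃² = D₁²D₂² + ‖u,_z(0)‖²_{L₂(Ω)} + ‖f₀‖²_{L₂(Ω^t)}`. [cite: Zajaczkowski2023, Assumption 1.1 p.5 l.28–30; (5.2) p.33] -/
def D3 : ℝ≥0∞ :=
  (D1 R a t f v ^ 2 * D2 R a t f v ^ 2 + Lp R a 2 (dZ (swirl (v 0))) ^ 2 +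
      Lpq R a 2 2 t (fun τ => swirl (f τ)) ^ 2) ^ (1 / 2 : ℝ)

/-- `D₄`, from `D₄² = D₁²(1 + D₂) + ‖u,_r(0)‖²_{L₂(Ω)} + ‖f₀‖²_{L₂(Ω^t)} + ‖f₀‖_{L₂(0,t;L_{4/3}(S₁))}` (last term
unsquared, as printed). [cite: Zajaczkowski2023, Assumption 1.1 p.5 l.31–35; (5.3) p.33] -/
def D4 : ℝ≥0∞ :=
  (D1 R a t f v ^ 2 * (1 + D2 R a t f v) + Lp R a 2 (dR (swirl (v 0))) ^ 2 +
      Lpq R a 2 2 t (fun τ => swirl (f τ)) ^ 2 + wallL43L2 R a t (fun τ => swirl (f τ))) ^ (1 / 2 : ℝ)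

/-- `D₅ = D₂(D₁ + D₂ + D₃)` (Assumption 1.1; Lemma 6.1 p.38 l.80 prints `D₂(D₁ + D₃ + D₄)` — variant recorded).
[cite: Zajaczkowski2023, Assumption 1.1 p.5 l.50] -/
def D5 : ℝ≥0∞ := D2 R a t f v * (D1 R a t f v + D2 R a t f v + D3 R a t f v)

/-- `D₆ = D₂^{1−ε₀}D₃`, «ε₀ is arbitrary small positive number». [cite: Zajaczkowski2023, Assumption 1.1 p.5 l.51–53] -/
def D6 : ℝ≥0∞ := D2 R a t f v ^ (1 - ε₀) * D3 R a t f v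

/-- `D₇ = ‖F_r‖²_{L₂(0,t;L_{6/5}(Ω))} + ‖F_z‖²_{L₂(0,t;L_{6/5}(Ω))} + ‖ω_r(0)‖²_{L₂(Ω)} + ‖ω_z(0)‖²_{L₂(Ω)}`,
`F = rot f`, `ω(0) = rot v(0)` (Lemma 6.1 p.38 l.84 adds `|f_φ|_{2,S₁^t}(D₃ + D₄)` — variant recorded).
[cite: Zajaczkowski2023, Assumption 1.1 p.5 l.55 – p.6 l.3; Lemma 6.1 p.38 l.80–109] -/
def D7 : ℝ≥0∞ :=
  Lpq R a (6 / 5) 2 t (fun τ => radialVelocity (curl (f τ))) ^ 2 +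
    Lpq R a (6 / 5) 2 t (fun τ => axialVelocity (curl (f τ))) ^ 2 +
    Lp R a 2 (radialVelocity (curl (v 0))) ^ 2 + Lp R a 2 (axialVelocity (curl (v 0))) ^ 2

/-- `D₈` WITHOUT the printed factor «φ(D₂)» (an unspecified increasing function — absorbed into the final `φ`, see the
module docstring): `‖F̄_r‖²_{L₂(0,t;L_{6/5}(Ω))} + ‖F̄_φ‖² + ‖Φ(0)‖²_{L₂(Ω)} + ‖Γ(0)‖²_{L₂(Ω)}`, `F̄ = F/r`.
[cite: Zajaczkowski2023, Assumption 1.1 p.6 l.4–12; (4.1) p.21 l.95–113] -/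
def D8 : ℝ≥0∞ :=
  Lpq R a (6 / 5) 2 t (fun τ x => radialVelocity (curl (f τ)) x / cylRadius x) ^ 2 +
    Lpq R a (6 / 5) 2 t (fun τ x => swirlVelocity (curl (f τ)) x / cylRadius x) ^ 2 +
    Lp R a 2 (PhiOf v 0) ^ 2 + Lp R a 2 (GammaOf v 0) ^ 2

/-- `D₉(12) = 12‖f_φ‖_{L_{12}(0,t;L_{36/25}(Ω))} + ‖v_φ(0)‖_{L_{12}(Ω)}`. [cite: Zajaczkowski2023, Assumption 1.1 p.6 l.13–18; Lemma 4.5 p.28] -/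
def D9 : ℝ≥0∞ := 12 * Lpq R a (36 / 25) 12 t (fun τ => swirlVelocity (f τ)) + Lp R a 12 (swirlVelocity (v 0))

/-- `D₁₀ = ‖f_φ/r‖_{L₁(0,t;L_∞(Ω))} + ‖v_φ(0)‖_{L_∞(Ω)}`. [cite: Zajaczkowski2023, Assumption 1.1 p.6 l.19–24; Lemma 4.7 p.29] -/
def D10 : ℝ≥0∞ :=
  Lpq R a ∞ 1 t (fun τ x => swirlVelocity (f τ) x / cylRadius x) + Lp R a ∞ (swirlVelocity (v 0))

/-- The data vector `(D₁, …, D₁₀)` of Assumption 1.1 on `Ω^t` (index `i` ↦ `D_{i+1}`).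
[cite: Zajaczkowski2023, Assumption 1.1 p.5 l.21 – p.6 l.24] -/
def dataVec : Fin 10 → ℝ≥0∞ :=
  ![D1 R a t f v, D2 R a t f v, D3 R a t f v, D4 R a t f v, D5 R a t f v, D6 R a ε₀ t f v, D7 R a t f v,
    D8 R a t f v, D9 R a t f v, D10 R a t f v]

/-- **Assumption 1.1**: «the following quantities are finite: D₁, …, D₁₀». [cite: Zajaczkowski2023, Assumption 1.1 p.5 l.21–22] -/
def Assumption11 : Prop := ∀ i : Fin 10, dataVec R a ε₀ t f v i < ⊤

/-- The real data vector fed to `φ` (finite under Assumption 1.1). [cite: Zajaczkowski2023, (1.24) p.6 l.27] -/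
def dataReal : Fin 10 → ℝ := fun i => (dataVec R a ε₀ t f v i).toReal

end Data

/-! ## §E. The claimed theorem (1.24) and its charitable restriction -/

/-- **Theorem 1.2 (1.24), as printed, BY NAME** — «Assume that Assumption 1.1 holds. Then there exists an increasing
positive function φ such that ‖Φ‖_{V(Ω^t)} + ‖Γ‖_{V(Ω^t)} ≤ φ(D₁, ⋯, D₁₀)»: for every cylinder (`R, a`), viscosity
`ν > 0` and `ε₀ ∈ (0,1)` (the parameter of `D₆`) there is ONE `φ`, increasing (for the product order) and positive,
such that every solution of the setting on `[0,T)` with finite data on `Ω^t`, `0 < t ≤ T`, obeys (1.24) on `Ω^t`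
(quantifier order `∃ φ ∀ solution`, as printed). [claim: Zajaczkowski2023, status: disputed]
[cite: Zajaczkowski2023, Theorem 1.2 (1.24) p.6 l.25–28; Assumption 1.1 p.5–6; Def 2.1 p.7 l.32–34] -/
def ClaimedTheorem : Prop :=
  ∀ (R a ν ε₀ : ℝ), 0 < R → 0 < a → 0 < ν → 0 < ε₀ → ε₀ < 1 →
    ∃ φ : (Fin 10 → ℝ) → ℝ, Monotone φ ∧ (∀ d, 0 < φ d) ∧
      ∀ (T : ℝ) (f v : ℝ → E3 → E3) (p : ℝ → E3 → ℝ) (ψ₁ : ℝ → E3 → ℝ), IsSolution R a ν T f v p ψ₁ →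
        ∀ t ∈ Ioc 0 T, Assumption11 R a ε₀ t f v →
          X R a t v ≤ ENNReal.ofReal (φ (dataReal R a ε₀ t f v))

/-- The solutions «such that ψ₁ vanishes on the axis of symmetry» (Lemma 3.3's hypothesis; by (1.21) equivalently
`v_z|_{r=0} = 0`, Remark 3.4) — the class the presented proof works in. [cite: Zajaczkowski2023, Lemma 3.3 p.17 l.26–27; Remark 3.4 p.18 l.53–55] -/
def VanishesOnAxis (T : ℝ) (ψ₁ : ℝ → E3 → ℝ) : Prop := ∀ t ∈ Ico 0 T, ∀ z : ℝ, ψ₁ t (axisPt z) = 0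

/-- **(1.24) restricted to the solutions with `ψ₁|_{r=0} = 0`** (CHARITABLE reading recorded for the referee:
Remark 3.4 «it imposes strong restrictions on solutions to (1.6) because the condition ψ₁|_{r=0} = 0 implies that
v_z|_{r=0} = 0. We do not know how to omit the restriction in the presented proof»). Not the printed Theorem 1.2.
[cite: Zajaczkowski2023, Remark 3.4 p.18 l.53–55; Theorem 1.2 p.6 l.25–28] -/
def ClaimedTheoremAxis : Prop :=
  ∀ (R a ν ε₀ : ℝ), 0 < R → 0 < a → 0 < ν → 0 < ε₀ → ε₀ < 1 →
    ∃ φ : (Fin 10 → ℝ) → ℝ, Monotone φ ∧ (∀ d, 0 < φ d) ∧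
      ∀ (T : ℝ) (f v : ℝ → E3 → E3) (p : ℝ → E3 → ℝ) (ψ₁ : ℝ → E3 → ℝ), IsSolution R a ν T f v p ψ₁ →
        VanishesOnAxis T ψ₁ → ∀ t ∈ Ioc 0 T, Assumption11 R a ε₀ t f v →
          X R a t v ≤ ENNReal.ofReal (φ (dataReal R a ε₀ t f v))

/-! ## §F. The steps of the printed plan (p.6 l.32 – p.7 l.10) -/

/-- Lemma 2.2's (2.1) and Lemma 2.3's (2.7) along a solution on `Ω^t`: «‖v(t)‖²_{L₂(Ω)} + ν∫_{Ω^t}(|∇v_r|² +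
|∇v_φ|² + |∇v_z|²) + ν∫_{Ω^t}(v_r²/r² + v_φ²/r²) ≤ 3‖f‖²_{L_{2,1}(Ω^t)} + 2‖v(0)‖²_{L₂(Ω)} ≡ D₁²» (the Cartesian
`‖Dv‖²_F` is the printed integrand) and «‖u(t)‖_{L_∞(Ω)} ≤ ‖f₀‖_{L_{∞,1}(Ω^t)} + ‖u(0)‖_{L_∞(Ω)} ≡ D₂».
[cite: Zajaczkowski2023, Lemma 2.2 (2.1) p.8 l.34–68; Lemma 2.3 (2.7) p.9 l.50–52] -/
def Ineq21_27 (R a ν t : ℝ) (f v : ℝ → E3 → E3) : Prop :=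
  (∀ s ∈ Ioo 0 t,
      Lp R a 2 (fun x => ‖v s x‖) ^ 2 +
          ENNReal.ofReal ν * ∫⁻ τ in Ioo 0 s, ∫⁻ x in cell R a, ENNReal.ofReal (frobeniusNormSq (fderiv ℝ (v τ) x)) ≤
        3 * Lpq R a 2 1 t (fun τ x => ‖f τ x‖) ^ 2 + 2 * Lp R a 2 (fun x => ‖v 0 x‖) ^ 2) ∧
    ∀ s ∈ Ioo 0 t, Lp R a ∞ (swirl (v s)) ≤ D2 R a t f v

/-- **Step 1 (plan item 1)** — Lemmas 2.2 and 2.3: the energy estimate (2.1) and the maximum principle (2.7) for the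
swirl `u = rv_φ` hold along every solution of the setting (TRUE-type, classical: the wall conditions kill the
boundary terms, `u|_{r=0} = 0`). [cite: Zajaczkowski2023, plan item 1 p.6 l.33–34; Lemma 2.2 p.8; Lemma 2.3 p.9] -/
def Step1_L22_L23 : Prop :=
  ∀ (R a ν T : ℝ) (f v : ℝ → E3 → E3) (p : ℝ → E3 → ℝ) (ψ₁ : ℝ → E3 → ℝ), IsSolution R a ν T f v p ψ₁ →
    ∀ t ∈ Ioc 0 T, Ineq21_27 R a ν t f v

/-- **Step 3 (plan item 3, p.6 l.40–43) — THE PRINT'S SELF-NAMED LOAD-BEARING SENTENCE, function grain**: «In Section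
3 for a given ω₁ ∈ H¹(Ω) many estimates for ψ₁ are found. In Lemma 3.3 we derived such estimate that ψ₁ must vanish
on the axis of symmetry. … The result of Lemma 3.3 shows that weak solutions proved in Lemma 2.5 must vanish on the
axis of symmetry.» Typed POINTWISE over concrete scalar fields on `ℝ³` (`SolvesStream`): for every `C^∞`
axisymmetric `2a`-periodic datum `ω₁` (`⊂ H¹(Ω)`), every `C^∞` axisymmetric `2a`-periodic `ψ₁` with `ψ₁|_{r=R} = 0`
solving (3.1) off the axis — the (weak, Lemma 2.5) solution for that `ω₁` — vanishes on the axis `{r = 0}`.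
(IMPLIED BY the printed sentence; cf. Remark 2.6 p.10 l.64–65 «the weak solution ψ₁ of (1.22) does not vanish on
the axis of symmetry» and Remark 3.4.) [claim: Zajaczkowski2023, status: disputed] [cite: Zajaczkowski2023, plan item 3 p.6 l.40–43; p.6 l.31; Lemma 2.5 p.10 l.43–47; Remark 2.6 p.10 l.64–65] -/
def Step3_PlanItem3 : Prop :=
  ∀ (R a : ℝ), 0 < R → 0 < a → ∀ ψ₁ ω₁ : E3 → ℝ, SolvesStream R a ψ₁ ω₁ → ∀ z : ℝ, ψ₁ (axisPt z) = 0

/-- **Step 3, solution grain** — «To prove (1.24) we need that ψ₁ and v_z vanish on the axis of symmetry» (p.6 l.31;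
abstract p.1 l.19–21; Remark 3.4): along every solution of the setting, `ψ₁ = 0` and `v_z = 0` on the axis at all
times. DERIVED from `Step3_PlanItem3` (`step3Axis_of_planItem3`). [claim: Zajaczkowski2023, status: disputed]
[cite: Zajaczkowski2023, p.6 l.31; Remark 3.4 p.18 l.53–55; abstract p.1 l.19–21] -/
def Step3_AxisVanishing : Prop :=
  ∀ (R a ν T : ℝ) (f v : ℝ → E3 → E3) (p : ℝ → E3 → ℝ) (ψ₁ : ℝ → E3 → ℝ), IsSolution R a ν T f v p ψ₁ →
    ∀ t ∈ Ico 0 T, ∀ z : ℝ, ψ₁ t (axisPt z) = 0 ∧ axialVelocity (v t) (axisPt z) = 0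

/-- The weighted estimate (3.25) for a solution `ψ₁` of (3.1) with datum `ω₁` on `Ω`, constant `c`:
«∫_Ω ψ²_{1,zz}/r² dx + ∫_Ω (ψ²_{1,zrr} + ψ²_{1,zr}/r² + ψ²_{1,z}/r⁴) dx ≤ c|ω_{1,z}|²_{2,Ω}» (`∫⁻`, so a divergent
left side is `⊤`). [cite: Zajaczkowski2023, (3.25) p.17 l.28–57] -/
def Ineq325 (R a c : ℝ) (ψ₁ ω₁ : E3 → ℝ) : Prop :=
  (∫⁻ x in cell R a,
      (ENNReal.ofReal (dZ (dZ ψ₁) x ^ 2 / cylRadius x ^ 2) + ENNReal.ofReal (dR (dR (dZ ψ₁)) x ^ 2) +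
        ENNReal.ofReal (dR (dZ ψ₁) x ^ 2 / cylRadius x ^ 2) + ENNReal.ofReal (dZ ψ₁ x ^ 2 / cylRadius x ^ 4))) ≤
    ENNReal.ofReal c * ∫⁻ x in cell R a, ENNReal.ofReal (dZ ω₁ x ^ 2)

/-- **Step 3′ — Lemma 3.3 AS PRINTED, WITH its hypothesis**: «Let ψ₁ be such weak solution to problem (3.1) that it
vanishes on the axis of symmetry. Then such sufficiently regular solutions to problem (3.1) satisfy the estimate
(3.25)» — for every cylinder there is `c > 0` such that every `SolvesStream R a ψ₁ ω₁` pair with, IN ADDITION,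
`ψ₁|_{r=0} = 0` satisfies (3.25) (proof via «Lemma 3.1 from [NZ]» = arXiv:2210.15729, (3.27)).
TRUE-type as printed; the discharge of its hypothesis is Step 3. [cite: Zajaczkowski2023, Lemma 3.3 (3.25) p.17 l.26–57; (3.27) p.17] -/
def Step_L33 : Prop :=
  ∀ (R a : ℝ), 0 < R → 0 < a → ∃ c : ℝ, 0 < c ∧ ∀ ψ₁ ω₁ : E3 → ℝ, SolvesStream R a ψ₁ ω₁ →
    (∀ z : ℝ, ψ₁ (axisPt z) = 0) → Ineq325 R a c ψ₁ ω₁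

/-- **Step 4 (plan item 4; §4 Lemma 4.1 … Remark 4.6)** — along a solution of the setting, FROM (2.1)/(2.7) (item 1)
and FROM (3.25) for the solution's `ψ₁(τ)` with `ω₁ = Γ(τ)` at every time `τ < t` (this is where the proof of Lemma 4.1, p.23
l.116–118 «where (3.25) is used», and of Lemma 6.1, p.43 l.117–119, consume Lemma 3.3), the bound (4.43) p.29:
«X² ≤ c(1 + |v_φ|^{2ε₀}_{∞,Ω^t})|v_φ|_{∞,Ω^t}^{(96ε/(ε₁−11ε₂))ε₀} + φ(D₅,D₇,D₈,D₉)» — typed with SOME `c, κ > 0`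
and SOME increasing `φ₄` of the data vector (weaker than print). [claim: Zajaczkowski2023, status: disputed]
[cite: Zajaczkowski2023, plan item 4 p.6 l.44 – p.7 l.4; Lemma 4.1 (4.1) p.21–24; Lemma 4.3 (4.23) p.27; Remark 4.6 (4.43) p.29] -/
def Step4_Sec4 : Prop :=
  ∀ (R a ν ε₀ : ℝ), 0 < R → 0 < a → 0 < ν → 0 < ε₀ → ε₀ < 1 →
    ∃ (C κ : ℝ) (φ₄ : (Fin 10 → ℝ) → ℝ), 0 < C ∧ 0 < κ ∧ Monotone φ₄ ∧ (∀ d, 0 ≤ φ₄ d) ∧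
      ∀ (T : ℝ) (f v : ℝ → E3 → E3) (p : ℝ → E3 → ℝ) (ψ₁ : ℝ → E3 → ℝ), IsSolution R a ν T f v p ψ₁ →
        ∀ t ∈ Ioc 0 T, Ineq21_27 R a ν t f v →
          (∃ c : ℝ, ∀ τ ∈ Ioo 0 t, ∃ ω₁ : E3 → ℝ,
              (∀ x ∈ cylinder R, cylRadius x ≠ 0 → ω₁ x = GammaOf v τ x) ∧ Ineq325 R a c (ψ₁ τ) ω₁) →
          Assumption11 R a ε₀ t f v →
            X R a t v ^ 2 ≤
              ENNReal.ofReal C * (1 + LinfST R a t (fun τ => swirlVelocity (v τ)) ^ (2 * ε₀)) *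
                  LinfST R a t (fun τ => swirlVelocity (v τ)) ^ (κ * ε₀) +
                ENNReal.ofReal (φ₄ (dataReal R a ε₀ t f v))

/-- **Step 5 (plan item 5; Lemma 4.7 (4.44) p.29)** — «there exists an increasing positive function φ such that
‖v_φ‖_{∞,Ω^t} ≤ φ(D₂,D₅,D₇,D₈,D₉, ‖f_φ/r‖_{L₁(0,t;L_∞(Ω))}, |v_φ(0)|_{∞,Ω})» (the last two = D₁₀), along the
solutions the section works with (those whose `ψ₁` vanishes on the axis), from (2.1)/(2.7).
[claim: Zajaczkowski2023, status: disputed] [cite: Zajaczkowski2023, plan item 5 p.7 l.5–10; Lemma 4.7 (4.44) p.29] -/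
def Step5_L47 : Prop :=
  ∀ (R a ν ε₀ : ℝ), 0 < R → 0 < a → 0 < ν → 0 < ε₀ → ε₀ < 1 →
    ∃ φ₇ : (Fin 10 → ℝ) → ℝ, Monotone φ₇ ∧ (∀ d, 0 ≤ φ₇ d) ∧
      ∀ (T : ℝ) (f v : ℝ → E3 → E3) (p : ℝ → E3 → ℝ) (ψ₁ : ℝ → E3 → ℝ), IsSolution R a ν T f v p ψ₁ →
        VanishesOnAxis T ψ₁ → ∀ t ∈ Ioc 0 T, Ineq21_27 R a ν t f v → Assumption11 R a ε₀ t f v →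
          LinfST R a t (fun τ => swirlVelocity (v τ)) ≤ ENNReal.ofReal (φ₇ (dataReal R a ε₀ t f v))

/-- **Step 6 (Remark 4.8 p.33 l.42)** — the closing algebra «Inequalities (4.43) and (4.44) imply (4.46) … The above
inequality proves Theorem 1.2»: from `X² ≤ C(1 + M^{2ε₀})M^{κε₀} + φ₄(D)` and `M ≤ φ₇(D)` one increasing positive
`φ` with `X ≤ φ(D)` (TRUE-type real analysis). [cite: Zajaczkowski2023, Remark 4.8 (4.46) p.33 l.35–42] -/
def Step6_R48 : Prop :=
  ∀ (ε₀ C κ : ℝ) (φ₄ φ₇ : (Fin 10 → ℝ) → ℝ), 0 < ε₀ → 0 < C → 0 < κ → Monotone φ₄ → Monotone φ₇ →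
    (∀ d, 0 ≤ φ₄ d) → (∀ d, 0 ≤ φ₇ d) →
      ∃ φ : (Fin 10 → ℝ) → ℝ, Monotone φ ∧ (∀ d, 0 < φ d) ∧
        ∀ (Xv M : ℝ≥0∞) (d : Fin 10 → ℝ),
          Xv ^ 2 ≤ ENNReal.ofReal C * (1 + M ^ (2 * ε₀)) * M ^ (κ * ε₀) + ENNReal.ofReal (φ₄ d) →
            M ≤ ENNReal.ofReal (φ₇ d) → Xv ≤ ENNReal.ofReal (φ d)

/-! ## §G. Kernel facts and the compositions (PROVED) -/

/-- On the axis the cylindrical radius vanishes. [folklore] -/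
private theorem cylRadius_axisPt (z : ℝ) : cylRadius (axisPt z) = 0 := by
  rw [cylRadius_eq_zero_iff]
  simp [axisPt, pt]

/-- **(1.21) on the axis: `v_z|_{r=0} = 2ψ₁|_{r=0}`** along a solution of the setting. [cite: Zajaczkowski2023, (1.21) p.5 l.3–6; Remark 3.4 p.18 l.53–55] -/
theorem IsSolution.axialVelocity_axis {R a ν T : ℝ} {f v : ℝ → E3 → E3} {p : ℝ → E3 → ℝ} {ψ₁ : ℝ → E3 → ℝ}
    (h : IsSolution R a ν T f v p ψ₁) {t : ℝ} (ht : t ∈ Ico 0 T) (z : ℝ) :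
    axialVelocity (v t) (axisPt z) = 2 * ψ₁ t (axisPt z) := by
  have hle : cylRadius (axisPt z) ≤ R := by
    rw [cylRadius_axisPt]
    exact h.R_pos.le
  have h2 := (h.stream t ht (axisPt z) hle).2
  rw [cylRadius_axisPt] at h2
  simpa using h2

/-- **Plan item 3 (function grain) ⇒ «ψ₁ and v_z vanish on the axis of symmetry» along every solution** (p.6 l.31,
l.42–43: «In view of properties of the stream function it means that v_z also vanishes on the axis»).
[cite: Zajaczkowski2023, plan item 3 p.6 l.40–43; (1.21) p.5 l.3–6] -/
theorem step3Axis_of_planItem3 (h3 : Step3_PlanItem3) : Step3_AxisVanishing := by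
  intro R a ν T f v p ψ₁ hS t ht z
  obtain ⟨ω₁, hsol, -⟩ := hS.stream_eq t ht
  have hψ : ∀ z' : ℝ, ψ₁ t (axisPt z') = 0 := h3 R a hS.R_pos hS.a_pos (ψ₁ t) ω₁ hsol
  refine ⟨hψ z, ?_⟩
  rw [hS.axialVelocity_axis ht z, hψ z, mul_zero]

/-- **The printed composition, PROVED**: items 1, 3 (function grain), 3′ (Lemma 3.3 as printed), 4, 5 and the closing
Remark 4.8 give Theorem 1.2 (1.24). Every binder is consumed: item 3 upgrades each solution to Lemma 3.3's
hypothesis, Lemma 3.3 then yields (3.25) for the solution's `ψ₁(τ)`, which §4 (Step 4) consumes with (2.1)/(2.7).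
[cite: Zajaczkowski2023, proof plan p.6 l.32 – p.7 l.10; Remark 4.8 p.33 l.42] -/
theorem claim_of_steps (h1 : Step1_L22_L23) (h3 : Step3_PlanItem3) (h33 : Step_L33) (h4 : Step4_Sec4)
    (h5 : Step5_L47) (h6 : Step6_R48) : ClaimedTheorem := by
  intro R a ν ε₀ hR ha hν hε hε1
  obtain ⟨C, κ, φ₄, hC, hκ, hφ₄m, hφ₄0, H4⟩ := h4 R a ν ε₀ hR ha hν hε hε1
  obtain ⟨φ₇, hφ₇m, hφ₇0, H5⟩ := h5 R a ν ε₀ hR ha hν hε hε1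
  obtain ⟨φ, hφm, hφ0, H6⟩ := h6 ε₀ C κ φ₄ φ₇ hε hC hκ hφ₄m hφ₇m hφ₄0 hφ₇0
  obtain ⟨c, hc, H33⟩ := h33 R a hR ha
  refine ⟨φ, hφm, hφ0, fun T f v p ψ₁ hS t ht hA => ?_⟩
  have hAx : Step3_AxisVanishing := step3Axis_of_planItem3 h3
  have hV : VanishesOnAxis T ψ₁ := fun s hs z => (hAx R a ν T f v p ψ₁ hS s hs z).1
  have h21 : Ineq21_27 R a ν t f v := h1 R a ν T f v p ψ₁ hS t ht
  have h325 : ∃ c : ℝ, ∀ τ ∈ Ioo 0 t, ∃ ω₁ : E3 → ℝ,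
      (∀ x ∈ cylinder R, cylRadius x ≠ 0 → ω₁ x = GammaOf v τ x) ∧ Ineq325 R a c (ψ₁ τ) ω₁ := by
    refine ⟨c, fun τ hτ => ?_⟩
    have hτT : τ ∈ Ico 0 T := ⟨hτ.1.le, lt_of_lt_of_le hτ.2 ht.2⟩
    obtain ⟨ω₁, hsol, hΓ⟩ := hS.stream_eq τ hτT
    exact ⟨ω₁, hΓ, H33 (ψ₁ τ) ω₁ hsol (hV τ hτT)⟩
  exact H6 _ _ _ (H4 T f v p ψ₁ hS t ht h21 h325 hA) (H5 T f v p ψ₁ hS hV t ht h21 hA)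

/-- **The charitable composition, PROVED**: WITHOUT plan item 3, items 1, 3′, 4, 5 and Remark 4.8 give (1.24) for
the solutions whose `ψ₁` vanishes on the axis (`ClaimedTheoremAxis`) — the class Remark 3.4 says the presented
proof is confined to. [cite: Zajaczkowski2023, Remark 3.4 p.18 l.53–55; Remark 4.8 p.33 l.42] -/
theorem claimAxis_of_steps (h1 : Step1_L22_L23) (h33 : Step_L33) (h4 : Step4_Sec4) (h5 : Step5_L47)
    (h6 : Step6_R48) : ClaimedTheoremAxis := by
  intro R a ν ε₀ hR ha hν hε hε1
  obtain ⟨C, κ, φ₄, hC, hκ, hφ₄m, hφ₄0, H4⟩ := h4 R a ν ε₀ hR ha hν hε hε1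
  obtain ⟨φ₇, hφ₇m, hφ₇0, H5⟩ := h5 R a ν ε₀ hR ha hν hε hε1
  obtain ⟨φ, hφm, hφ0, H6⟩ := h6 ε₀ C κ φ₄ φ₇ hε hC hκ hφ₄m hφ₇m hφ₄0 hφ₇0
  obtain ⟨c, hc, H33⟩ := h33 R a hR ha
  refine ⟨φ, hφm, hφ0, fun T f v p ψ₁ hS hV t ht hA => ?_⟩
  have h21 : Ineq21_27 R a ν t f v := h1 R a ν T f v p ψ₁ hS t ht
  have h325 : ∃ c : ℝ, ∀ τ ∈ Ioo 0 t, ∃ ω₁ : E3 → ℝ,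
      (∀ x ∈ cylinder R, cylRadius x ≠ 0 → ω₁ x = GammaOf v τ x) ∧ Ineq325 R a c (ψ₁ τ) ω₁ := by
    refine ⟨c, fun τ hτ => ?_⟩
    have hτT : τ ∈ Ico 0 T := ⟨hτ.1.le, lt_of_lt_of_le hτ.2 ht.2⟩
    obtain ⟨ω₁, hsol, hΓ⟩ := hS.stream_eq τ hτT
    exact ⟨ω₁, hΓ, H33 (ψ₁ τ) ω₁ hsol (hV τ hτT)⟩
  exact H6 _ _ _ (H4 T f v p ψ₁ hS t ht h21 h325 hA) (H5 T f v p ψ₁ hS hV t ht h21 hA)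

/-- The printed Theorem 1.2 implies its restriction to the solutions with `ψ₁|_{r=0} = 0` (trivially).
[cite: Zajaczkowski2023, Theorem 1.2 p.6 l.25–28; Remark 3.4 p.18 l.53–55] -/
theorem claimedTheoremAxis_of_claimedTheorem (h : ClaimedTheorem) : ClaimedTheoremAxis := by
  intro R a ν ε₀ hR ha hν hε hε1
  obtain ⟨φ, hφm, hφ0, H⟩ := h R a ν ε₀ hR ha hν hε hε1
  exact ⟨φ, hφm, hφ0, fun T f v p ψ₁ hS _ t ht hA => H T f v p ψ₁ hS t ht hA⟩

/-! ## §H. Remark 4.8's closing algebra is TRUE (rev 2, additive; typist-4 g7)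

`Step6_R48` — «Inequalities (4.43) and (4.44) imply (4.46) … The above inequality proves Theorem 1.2» — is
elementary real analysis: with `φ(d) := √(C(1 + φ₇(d)^{2ε₀})φ₇(d)^{κε₀} + φ₄(d)) + 1`, increasing and positive,
`X² ≤ C(1 + M^{2ε₀})M^{κε₀} + φ₄(d)` and `M ≤ φ₇(d)` give `X ≤ φ(d)`. Proved here, so the binder `h6` of
`claim_of_steps` is discharged in the kernel (`claim_of_steps'`). Theorems only (no new definitions). -/

/-- **Remark 4.8 holds**: the closing algebra «(4.43) and (4.44) imply (4.46)» is a theorem.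
[cite: Zajaczkowski2023, Remark 4.8 (4.46) p.33 l.35–42] -/
theorem step6_R48_holds : Step6_R48 := by
  intro ε₀ C κ φ₄ φ₇ hε hC hκ hφ₄m hφ₇m hφ₄0 hφ₇0
  have h2ε : 0 ≤ 2 * ε₀ := by positivity
  have hκε : 0 ≤ κ * ε₀ := by positivity
  -- the radicand is nonnegative and increasing in `d`
  have hrad0 : ∀ d, 0 ≤ C * (1 + φ₇ d ^ (2 * ε₀)) * φ₇ d ^ (κ * ε₀) + φ₄ d := fun d => by
    have h1 : 0 ≤ φ₇ d ^ (2 * ε₀) := Real.rpow_nonneg (hφ₇0 d) _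
    have h2 : 0 ≤ φ₇ d ^ (κ * ε₀) := Real.rpow_nonneg (hφ₇0 d) _
    have := hφ₄0 d
    positivity
  refine ⟨fun d => Real.sqrt (C * (1 + φ₇ d ^ (2 * ε₀)) * φ₇ d ^ (κ * ε₀) + φ₄ d) + 1, ?_, ?_, ?_⟩
  · -- monotone
    intro d d' hdd'
    have h7 : φ₇ d ≤ φ₇ d' := hφ₇m hdd'
    have h4 : φ₄ d ≤ φ₄ d' := hφ₄m hdd'
    have ha : φ₇ d ^ (2 * ε₀) ≤ φ₇ d' ^ (2 * ε₀) := Real.rpow_le_rpow (hφ₇0 d) h7 h2ε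
    have hb : φ₇ d ^ (κ * ε₀) ≤ φ₇ d' ^ (κ * ε₀) := Real.rpow_le_rpow (hφ₇0 d) h7 hκε
    have ha0 : 0 ≤ φ₇ d ^ (2 * ε₀) := Real.rpow_nonneg (hφ₇0 d) _
    have hb0 : 0 ≤ φ₇ d ^ (κ * ε₀) := Real.rpow_nonneg (hφ₇0 d) _
    have hb0' : 0 ≤ φ₇ d' ^ (κ * ε₀) := Real.rpow_nonneg (hφ₇0 d') _
    have hprod : C * (1 + φ₇ d ^ (2 * ε₀)) * φ₇ d ^ (κ * ε₀) ≤
        C * (1 + φ₇ d' ^ (2 * ε₀)) * φ₇ d' ^ (κ * ε₀) := by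
      have hC0 : 0 ≤ C := hC.le
      have h1 : C * (1 + φ₇ d ^ (2 * ε₀)) ≤ C * (1 + φ₇ d' ^ (2 * ε₀)) := by nlinarith
      have h1' : 0 ≤ C * (1 + φ₇ d' ^ (2 * ε₀)) := by
        have : 0 ≤ φ₇ d' ^ (2 * ε₀) := Real.rpow_nonneg (hφ₇0 d') _
        positivity
      calc C * (1 + φ₇ d ^ (2 * ε₀)) * φ₇ d ^ (κ * ε₀)
          ≤ C * (1 + φ₇ d' ^ (2 * ε₀)) * φ₇ d ^ (κ * ε₀) := mul_le_mul_of_nonneg_right h1 hb0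
        _ ≤ C * (1 + φ₇ d' ^ (2 * ε₀)) * φ₇ d' ^ (κ * ε₀) := mul_le_mul_of_nonneg_left hb h1'
    have := Real.sqrt_le_sqrt (by linarith : C * (1 + φ₇ d ^ (2 * ε₀)) * φ₇ d ^ (κ * ε₀) + φ₄ d ≤
      C * (1 + φ₇ d' ^ (2 * ε₀)) * φ₇ d' ^ (κ * ε₀) + φ₄ d')
    show Real.sqrt (C * (1 + φ₇ d ^ (2 * ε₀)) * φ₇ d ^ (κ * ε₀) + φ₄ d) + 1 ≤
      Real.sqrt (C * (1 + φ₇ d' ^ (2 * ε₀)) * φ₇ d' ^ (κ * ε₀) + φ₄ d') + 1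
    linarith
  · -- positive
    intro d
    have := Real.sqrt_nonneg (C * (1 + φ₇ d ^ (2 * ε₀)) * φ₇ d ^ (κ * ε₀) + φ₄ d)
    show 0 < Real.sqrt (C * (1 + φ₇ d ^ (2 * ε₀)) * φ₇ d ^ (κ * ε₀) + φ₄ d) + 1
    linarith
  · -- the implication
    intro Xv M d hX hM
    set a : ℝ := φ₇ d ^ (2 * ε₀) with ha_def
    set b : ℝ := φ₇ d ^ (κ * ε₀) with hb_def
    have ha0 : 0 ≤ a := Real.rpow_nonneg (hφ₇0 d) _
    have hb0 : 0 ≤ b := Real.rpow_nonneg (hφ₇0 d) _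
    have hMa : M ^ (2 * ε₀) ≤ ENNReal.ofReal a := by
      rw [ha_def, ← ENNReal.ofReal_rpow_of_nonneg (hφ₇0 d) h2ε]
      exact ENNReal.rpow_le_rpow hM h2ε
    have hMb : M ^ (κ * ε₀) ≤ ENNReal.ofReal b := by
      rw [hb_def, ← ENNReal.ofReal_rpow_of_nonneg (hφ₇0 d) hκε]
      exact ENNReal.rpow_le_rpow hM hκε
    set A : ℝ := C * (1 + a) * b + φ₄ d with hA_def
    have hA0 : 0 ≤ A := hrad0 d
    have hRHS : ENNReal.ofReal C * (1 + M ^ (2 * ε₀)) * M ^ (κ * ε₀) + ENNReal.ofReal (φ₄ d) ≤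
        ENNReal.ofReal A := by
      calc ENNReal.ofReal C * (1 + M ^ (2 * ε₀)) * M ^ (κ * ε₀) + ENNReal.ofReal (φ₄ d)
          ≤ ENNReal.ofReal C * (1 + ENNReal.ofReal a) * ENNReal.ofReal b + ENNReal.ofReal (φ₄ d) := by
            gcongr
        _ = ENNReal.ofReal A := by
            rw [hA_def, ENNReal.ofReal_add (by positivity) (hφ₄0 d), ENNReal.ofReal_mul (by positivity),
              ENNReal.ofReal_mul hC.le, ENNReal.ofReal_add zero_le_one ha0, ENNReal.ofReal_one]
    have hX2 : Xv ^ 2 ≤ ENNReal.ofReal A := hX.trans hRHS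
    -- `Xv` is finite
    have hXtop : Xv ≠ ⊤ := by
      intro h
      rw [h, ENNReal.top_pow two_ne_zero] at hX2
      exact ENNReal.ofReal_ne_top (top_le_iff.mp hX2)
    -- pass to reals
    have hx0 : 0 ≤ Xv.toReal := ENNReal.toReal_nonneg
    have hXeq : Xv = ENNReal.ofReal Xv.toReal := (ENNReal.ofReal_toReal hXtop).symm
    have hx2 : Xv.toReal ^ 2 ≤ A := by
      have h' : ENNReal.ofReal (Xv.toReal ^ 2) ≤ ENNReal.ofReal A := by
        rw [ENNReal.ofReal_pow hx0, ← hXeq]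
        exact hX2
      exact (ENNReal.ofReal_le_ofReal_iff hA0).mp h'
    have hxle : Xv.toReal ≤ Real.sqrt A := Real.le_sqrt_of_sq_le hx2
    rw [hXeq]
    refine ENNReal.ofReal_le_ofReal ?_
    show Xv.toReal ≤ Real.sqrt (C * (1 + φ₇ d ^ (2 * ε₀)) * φ₇ d ^ (κ * ε₀) + φ₄ d) + 1
    rw [← ha_def, ← hb_def, ← hA_def]
    linarith

/-- **The printed composition with Remark 4.8 discharged**: items 1, 3, 3′, 4, 5 ⇒ Theorem 1.2 (1.24).
[cite: Zajaczkowski2023, proof plan p.6 l.32 – p.7 l.10; Remark 4.8 p.33 l.42] -/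
theorem claim_of_steps' (h1 : Step1_L22_L23) (h3 : Step3_PlanItem3) (h33 : Step_L33) (h4 : Step4_Sec4)
    (h5 : Step5_L47) : ClaimedTheorem :=
  claim_of_steps h1 h3 h33 h4 h5 step6_R48_holds

/-- **The charitable composition with Remark 4.8 discharged**: items 1, 3′, 4, 5 ⇒ (1.24) on the axis-vanishing
class. [cite: Zajaczkowski2023, Remark 3.4 p.18 l.53–55; Remark 4.8 p.33 l.42] -/
theorem claimAxis_of_steps' (h1 : Step1_L22_L23) (h33 : Step_L33) (h4 : Step4_Sec4) (h5 : Step5_L47) :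
    ClaimedTheoremAxis :=
  claimAxis_of_steps h1 h33 h4 h5 step6_R48_holds


/-! ## §I. Step 1 is TRUE: Lemma 2.2 (energy inequality (2.1)) and Lemma 2.3 (maximum principle (2.7)) along every
solution of the setting (rev 3, additive; typist-4 g8 — DISCHARGE lane, D-0026: theorems only)

The period cell `Ω = cell R a = {r < R} × (−a, a)`; all fields of `IsSolution` are `C^∞` on `ℝ × ℝ³`, so the
analysis runs with global derivatives; integrals over `Ω` and over `closure Ω` agree (the boundary of the convex
cell is null). -/

open Filter Topology InnerProductSpace
open scoped NNReal

/-! ### §I.1 Geometry of the period cell `Ω = {r < R, |z| < a}` -/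

/-- The closed period cell `{r ≤ R, |z| ≤ a}`. [folklore] -/
private theorem isCompact_closedCell (R a : ℝ) : IsCompact {x : E3 | cylRadius x ≤ R ∧ x 2 ∈ Icc (-a) a} := by
  refine Metric.isCompact_of_isClosed_isBounded ?_ ?_
  · exact (isClosed_le continuous_cylRadius continuous_const).inter
      (isClosed_Icc.preimage (EuclideanSpace.proj (2 : Fin 3)).continuous)
  · rw [Metric.isBounded_iff_subset_closedBall (0 : E3)]
    refine ⟨Real.sqrt (R ^ 2 + a ^ 2), fun x hx => ?_⟩
    obtain ⟨hr, hz⟩ := hx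
    rw [Metric.mem_closedBall, dist_zero_right, EuclideanSpace.norm_eq]
    refine Real.sqrt_le_sqrt ?_
    have h0 := cylRadius_nonneg x
    have h1 : x 0 ^ 2 + x 1 ^ 2 ≤ R ^ 2 := by rw [← cylRadius_sq]; nlinarith
    have h2 : x 2 ^ 2 ≤ a ^ 2 := by obtain ⟨hl, hu⟩ := hz; nlinarith
    simp only [Fin.sum_univ_three, Real.norm_eq_abs, sq_abs]
    linarith

/-- The period cell is open. [folklore] -/
private theorem isOpen_cell (R a : ℝ) : IsOpen (cell R a) :=
  (isOpen_lt continuous_cylRadius continuous_const).inter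
    (isOpen_Ioo.preimage (EuclideanSpace.proj (2 : Fin 3)).continuous)

/-- The period cell is measurable. [folklore] -/
private theorem measurableSet_cell (R a : ℝ) : MeasurableSet (cell R a) := (isOpen_cell R a).measurableSet

/-- The period cell lies in the open cylinder. [folklore] -/
private theorem cell_subset_cylinder (R a : ℝ) : cell R a ⊆ (cylinder R : Set E3) := fun _ hx => hx.1

/-- The closure of the period cell lies in the closed cell. [folklore] -/
private theorem closure_cell_subset (R a : ℝ) : closure (cell R a) ⊆ {x : E3 | cylRadius x ≤ R ∧ x 2 ∈ Icc (-a) a} :=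
  closure_minimal (fun _ hx => ⟨hx.1.le, Ioo_subset_Icc_self hx.2⟩)
    ((isClosed_le continuous_cylRadius continuous_const).inter
      (isClosed_Icc.preimage (EuclideanSpace.proj (2 : Fin 3)).continuous))

/-- The closure of the period cell is compact. [folklore] -/
private theorem isCompact_closure_cell (R a : ℝ) : IsCompact (closure (cell R a)) :=
  (isCompact_closedCell R a).of_isClosed_subset isClosed_closure (closure_cell_subset R a)

/-- The period cell has finite volume. [folklore] -/
private theorem volume_cell_lt_top (R a : ℝ) : volume (cell R a) < ⊤ :=
  (measure_mono subset_closure).trans_lt (isCompact_closure_cell R a).measure_lt_top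

/-- `{r ≤ R, |z| ≤ a}` and the open cell agree up to a Lebesgue-null set (the two axial levels `z = ±a`
and the wall `r = R`, the latter inside `{r ≤ R} ∖ {r < R}` which we avoid by using `r < R`). [folklore] -/
private theorem iccCell_ae_eq_cell (R a : ℝ) :
    ({x : E3 | cylRadius x < R ∧ x 2 ∈ Icc (-a) a} : Set E3) =ᵐ[volume] cell R a := by
  have hnull : volume ({x : E3 | x 2 = -a} ∪ {x : E3 | x 2 = a}) = 0 :=
    measure_union_null (volume_setOf_apply_two_eq (-a)) (volume_setOf_apply_two_eq a)
  refine ae_eq_set.2 ⟨?_, ?_⟩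
  · refine measure_mono_null (fun x hx => ?_) hnull
    obtain ⟨⟨hr, hz0, hz1⟩, hx2⟩ := hx
    have hx2' : ¬ (cylRadius x < R ∧ x 2 ∈ Ioo (-a) a) := hx2
    rcases hz0.lt_or_eq with h0 | h0
    · rcases hz1.lt_or_eq with h1 | h1
      · exact absurd ⟨hr, h0, h1⟩ hx2'
      · exact Or.inr h1
    · exact Or.inl h0.symm
  · refine measure_mono_null (fun x hx => ?_) (measure_empty (μ := (volume : Measure E3)))
    exact hx.2 ⟨hx.1.1, Ioo_subset_Icc_self hx.1.2⟩

/-! ### §I.2 Gauss–Green on the period cell of radius `R` (from the tree's unit-radius identity) -/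

/-- The affine chart `y ↦ R y − a e_z = (−a)e_z + R y` carries radii to `R`-fold radii. [folklore] -/
private theorem cylRadius_chart {R : ℝ} (hR : 0 < R) (a : ℝ) (y : E3) :
    cylRadius ((-a) • eZ + R • y) = R * cylRadius y := by
  rw [cylRadius_smul_eZ_add_smul, abs_of_pos hR]

/-- The chart does not change the radial unit vector. [folklore] -/
private theorem eR_chart {R : ℝ} (hR : 0 < R) (a : ℝ) (y : E3) : eR ((-a) • eZ + R • y) = eR y :=
  eR_smul_eZ_add_smul _ hR y

/-- The height coordinate of the chart. [folklore] -/
private theorem chart_apply_two (R a : ℝ) (y : E3) : ((-a) • eZ + R • y) 2 = R * y 2 - a := by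
  simp [eZ]
  ring

/-- The chart is smooth. [folklore] -/
private theorem contDiff_chart (R a : ℝ) : ContDiff ℝ ∞ (fun y : E3 => (-a) • eZ + R • y) :=
  contDiff_const.add (contDiff_const_smul R)

/-- The derivative of the chart is `R · id`. [folklore] -/
private theorem hasFDerivAt_chart (R a : ℝ) (y : E3) :
    HasFDerivAt (fun y : E3 => (-a) • eZ + R • y) (R • ContinuousLinearMap.id ℝ E3) y :=
  ((hasFDerivAt_id y).const_smul R).const_add _

/-- `div (V ∘ chart)(y) = R · (div V)(chart y)`. [folklore] -/
private theorem divergence_comp_chart {R a : ℝ} {V : E3 → E3} {y : E3} (hV : DifferentiableAt ℝ V ((-a) • eZ + R • y)) :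
    VectorCalculus.divergence (V ∘ fun y : E3 => (-a) • eZ + R • y) y =
      R * VectorCalculus.divergence V ((-a) • eZ + R • y) := by
  have h := hV.hasFDerivAt.comp y (hasFDerivAt_chart R a y)
  rw [VectorCalculus.divergence, VectorCalculus.divergence, h.fderiv]
  have : ((fderiv ℝ V ((-a) • eZ + R • y)).comp (R • ContinuousLinearMap.id ℝ E3) : E3 →ₗ[ℝ] E3) =
      R • (fderiv ℝ V ((-a) • eZ + R • y) : E3 →ₗ[ℝ] E3) := by
    ext v
    simp
  rw [this, map_smul, smul_eq_mul]

/-- The unit period cell of length `2a/R` is the preimage of `{r < R} × [−a, a]` under the chart. [folklore] -/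
private theorem preimage_chart_iccCell {R a : ℝ} (hR : 0 < R) :
    (fun y : E3 => (-a) • eZ + R • y) ⁻¹' {x : E3 | cylRadius x < R ∧ x 2 ∈ Icc (-a) a} =
      {y : E3 | cylRadius y < 1 ∧ y 2 ∈ Icc 0 (2 * a / R)} := by
  ext y
  simp only [mem_preimage, mem_setOf_eq, cylRadius_chart hR, chart_apply_two, mem_Icc]
  constructor
  · rintro ⟨hr, hz0, hz1⟩
    refine ⟨?_, ?_, ?_⟩
    · nlinarith
    · nlinarith
    · rw [le_div_iff₀ hR]; nlinarith
  · rintro ⟨hr, hz0, hz1⟩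
    rw [le_div_iff₀ hR] at hz1
    refine ⟨?_, ?_, ?_⟩ <;> nlinarith

/-- **Gauss–Green on the period cell `Ω = {r < R} × (−a, a)`**: for a `C¹` field tangential on the wall
`{r = R}` and `2a`-periodic in `z`, `∫_Ω div V = 0` — the tree's unit-radius identity
`setIntegral_divergence_periodCell_eq_zero` transported by the chart `y ↦ R y − a e_z`. [folklore] -/
private theorem setIntegral_divergence_cell_eq_zero {R a : ℝ} (hR : 0 < R) (ha : 0 < a) {V : E3 → E3}
    (hV : ContDiff ℝ 1 V) (hslip : ∀ x : E3, cylRadius x = R → ⟪V x, eR x⟫ = 0)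
    (hper : IsAxiallyPeriodic (2 * a) V) :
    ∫ x in cell R a, VectorCalculus.divergence V x = 0 := by
  set L : ℝ := 2 * a / R with hL_def
  have hL : 0 < L := by positivity
  set W : E3 → E3 := V ∘ fun y : E3 => (-a) • eZ + R • y with hW_def
  have hWc : ContDiffOn ℝ 1 W (closure (unitCylinder : Set E3)) :=
    (hV.comp ((contDiff_chart R a).of_le (by exact_mod_cast le_top))).contDiffOn
  have hWslip : ∀ x ∈ frontier (unitCylinder : Set E3), ⟪W x, eR x⟫ = 0 := by
    intro x hx
    rw [frontier_unitCylinder] at hx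
    have hxR : cylRadius ((-a) • eZ + R • x) = R := by
      rw [cylRadius_chart hR, show cylRadius x = 1 from hx, mul_one]
    show ⟪V ((-a) • eZ + R • x), eR x⟫ = 0
    rw [← eR_chart hR a x]
    exact hslip _ hxR
  have hWper : IsAxiallyPeriodic L W := by
    intro y
    show V ((-a) • eZ + R • (y + L • EuclideanSpace.single 2 1)) = V ((-a) • eZ + R • y)
    have : (-a) • eZ + R • (y + L • EuclideanSpace.single 2 1) =
        ((-a) • eZ + R • y) + (2 * a) • EuclideanSpace.single (2 : Fin 3) (1 : ℝ) := by
      simp only [smul_add, smul_smul, hL_def]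
      rw [mul_div_cancel₀ _ hR.ne']
      abel
    rw [this, hper]
  have h0 := setIntegral_divergence_periodCell_eq_zero hL hWc hWslip hWper
  -- `div W = R · (div V) ∘ chart`
  have hdiff : ∀ y, DifferentiableAt ℝ V ((-a) • eZ + R • y) := fun y => hV.differentiable one_ne_zero _
  have h1 : ∫ y in {y : E3 | cylRadius y < 1 ∧ y 2 ∈ Icc 0 L},
      VectorCalculus.divergence V ((-a) • eZ + R • y) = 0 := by
    have : ∫ y in {y : E3 | cylRadius y < 1 ∧ y 2 ∈ Icc 0 L}, VectorCalculus.divergence W y =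
        R * ∫ y in {y : E3 | cylRadius y < 1 ∧ y 2 ∈ Icc 0 L}, VectorCalculus.divergence V ((-a) • eZ + R • y) := by
      rw [← integral_const_mul]
      exact integral_congr_ae (Eventually.of_forall fun y => divergence_comp_chart (hdiff y))
    rw [this] at h0
    exact (mul_eq_zero.1 h0).resolve_left hR.ne'
  -- change of variables `x = chart y`
  set SR : Set E3 := {x : E3 | cylRadius x < R ∧ x 2 ∈ Icc (-a) a} with hSR
  have hSRm : MeasurableSet SR :=
    (measurableSet_lt continuous_cylRadius.measurable measurable_const).inter
      (measurableSet_Icc.preimage (EuclideanSpace.proj (2 : Fin 3)).continuous.measurable)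
  have h2 : ∫ y in {y : E3 | cylRadius y < 1 ∧ y 2 ∈ Icc 0 L}, VectorCalculus.divergence V ((-a) • eZ + R • y) =
      (R ^ 3)⁻¹ * ∫ x in SR, VectorCalculus.divergence V x := by
    rw [← preimage_chart_iccCell hR, ← integral_indicator (hSRm.preimage (contDiff_chart R a).continuous.measurable)]
    have hind : ((fun y : E3 => (-a) • eZ + R • y) ⁻¹' SR).indicator
        (fun y => VectorCalculus.divergence V ((-a) • eZ + R • y)) =
        fun y => SR.indicator (VectorCalculus.divergence V) ((-a) • eZ + R • y) := by
      funext y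
      exact Set.indicator_comp_right (fun y : E3 => (-a) • eZ + R • y) (g := VectorCalculus.divergence V) (x := y)
    rw [hind, Measure.integral_comp_smul_of_nonneg volume
      (fun x => SR.indicator (VectorCalculus.divergence V) ((-a) • eZ + x)) R (hR := hR.le),
      integral_add_left_eq_self, integral_indicator hSRm]
    simp [finrank_euclideanSpace]
  rw [h2] at h1
  have h3 : ∫ x in SR, VectorCalculus.divergence V x = 0 :=
    (mul_eq_zero.1 h1).resolve_left (by positivity)
  rwa [setIntegral_congr_set (iccCell_ae_eq_cell R a)] at h3

/-! ### §I.3 The cell up to null sets; parametric integrals over the cell -/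

/-- The period cell is convex (a cylinder over a ball intersected with a slab). [folklore] -/
private theorem convex_cell (R a : ℝ) : Convex ℝ (cell R a) := by
  have h : cell R a = horizontalProj ⁻¹' Metric.ball (0 : E3) R ∩
      (EuclideanSpace.proj (2 : Fin 3) : E3 →L[ℝ] ℝ) ⁻¹' Ioo (-a) a := by
    ext x
    simp only [cell, mem_setOf_eq, mem_inter_iff, mem_preimage, Metric.mem_ball, dist_zero_right,
      norm_horizontalProj]
    rfl
  rw [h]
  exact ((convex_ball (0 : E3) R).linear_preimage horizontalProj).inter
    ((convex_Ioo (-a) a).linear_preimage (EuclideanSpace.proj (2 : Fin 3) : E3 →L[ℝ] ℝ).toLinearMap)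

/-- The boundary of the (convex) period cell is Lebesgue-null. [folklore] -/
private theorem volume_frontier_cell (R a : ℝ) : volume (frontier (cell R a)) = 0 :=
  (convex_cell R a).addHaar_frontier volume

/-- The closed and the open period cell agree almost everywhere. [folklore] -/
private theorem closure_cell_ae_eq (R a : ℝ) : closure (cell R a) =ᵐ[volume] cell R a := by
  rw [closure_eq_self_union_frontier]
  exact union_ae_eq_left_of_ae_eq_empty (ae_eq_empty.2 (volume_frontier_cell R a))

/-- **Parametric integrals over the cell of jointly continuous integrands are continuous** (dominated
convergence on the compact closed cell, Mathlib `continuous_parametric_integral_of_continuous`). [folklore] -/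
private theorem continuous_cellIntegral {R a : ℝ} {G : ℝ → E3 → ℝ} (hG : Continuous (uncurry G)) :
    Continuous fun s => ∫ x in cell R a, G s x := by
  have h := continuous_parametric_integral_of_continuous (μ := (volume : Measure E3)) hG
    (isCompact_closure_cell R a)
  refine h.congr fun s => ?_
  exact setIntegral_congr_set (closure_cell_ae_eq R a)

/-- A continuous function is integrable on the cell. [folklore] -/
private theorem integrableOn_cell_of_continuous {R a : ℝ} {F : Type*} [NormedAddCommGroup F] {g : E3 → F}
    (hg : Continuous g) : IntegrableOn g (cell R a) volume :=
  (hg.continuousOn.integrableOn_compact (isCompact_closure_cell R a)).mono_set subset_closure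

/-! ### §I.4 The viscous flux `W = ∇(½|v|²)`, the azimuthal vorticity on the wall, pointwise identities -/

/-- The viscous flux `W(y) = Σᵢ ⟪Dv(y)eᵢ, v(y)⟫ eᵢ = ∇(½|v|²)(y)` has `⟪W(y), h⟫ = ⟪Dv(y) h, v(y)⟫. [folklore] -/
private theorem inner_viscFlux (v : E3 → E3) (y h : E3) :
    ⟪∑ i : Fin 3, ⟪fderiv ℝ v y ((EuclideanSpace.basisFun (Fin 3) ℝ) i), v y⟫ • (EuclideanSpace.basisFun (Fin 3) ℝ) i, h⟫ =
      ⟪fderiv ℝ v y h, v y⟫ := by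
  conv_rhs => rw [← (EuclideanSpace.basisFun (Fin 3) ℝ).sum_repr' h]
  simp only [sum_inner, real_inner_smul_left, map_sum, map_smul]
  refine Finset.sum_congr rfl fun i _ => ?_
  ring

/-- The components `y ↦ ⟪Dv(y)eᵢ, v(y)⟫` of the flux are `C¹` for `v ∈ C²`. [folklore] -/
private theorem contDiff_inner_fderiv_apply {v : E3 → E3} (hv : ContDiff ℝ 2 v) (i : Fin 3) :
    ContDiff ℝ 1 fun y => ⟪fderiv ℝ v y ((EuclideanSpace.basisFun (Fin 3) ℝ) i), v y⟫ :=
  ((hv.fderiv_right (m := 1) le_rfl).clm_apply contDiff_const).inner ℝ (hv.of_le one_le_two)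

/-- The flux is `C¹` for `v ∈ C²`. [folklore] -/
private theorem contDiff_viscFlux {v : E3 → E3} (hv : ContDiff ℝ 2 v) :
    ContDiff ℝ 1 (fun y : E3 => ∑ i : Fin 3, ⟪fderiv ℝ v y ((EuclideanSpace.basisFun (Fin 3) ℝ) i), v y⟫ • (EuclideanSpace.basisFun (Fin 3) ℝ) i) :=
  ContDiff.sum fun i _ => (contDiff_inner_fderiv_apply hv i).smul contDiff_const

/-- The derivative of the flux. [folklore] -/
private theorem hasFDerivAt_viscFlux {v : E3 → E3} (hv : ContDiff ℝ 2 v) (x : E3) :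
    HasFDerivAt (fun y : E3 => ∑ i : Fin 3, ⟪fderiv ℝ v y ((EuclideanSpace.basisFun (Fin 3) ℝ) i), v y⟫ • (EuclideanSpace.basisFun (Fin 3) ℝ) i)
      (∑ i : Fin 3, (fderiv ℝ (fun y => ⟪fderiv ℝ v y ((EuclideanSpace.basisFun (Fin 3) ℝ) i), v y⟫) x).smulRight ((EuclideanSpace.basisFun (Fin 3) ℝ) i)) x :=
  HasFDerivAt.fun_sum fun i _ =>
    ((contDiff_inner_fderiv_apply hv i).differentiable one_ne_zero x).hasFDerivAt.smul_const ((EuclideanSpace.basisFun (Fin 3) ℝ) i)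

/-- **`div W = ⟪Δv, v⟫ + |Dv|²`** for `v ∈ C²`. [folklore] -/
private theorem divergence_viscFlux {v : E3 → E3} (hv : ContDiff ℝ 2 v) (x : E3) :
    VectorCalculus.divergence (fun y : E3 => ∑ i : Fin 3, ⟪fderiv ℝ v y ((EuclideanSpace.basisFun (Fin 3) ℝ) i), v y⟫ • (EuclideanSpace.basisFun (Fin 3) ℝ) i) x =
      ⟪Δ v x, v x⟫ + frobeniusNormSq (fderiv ℝ v x) := by
  have hv1 : ContDiff ℝ 1 v := hv.of_le one_le_two
  have hdw : ∀ i, ContDiff ℝ 1 fun y => fderiv ℝ v y ((EuclideanSpace.basisFun (Fin 3) ℝ) i) := fun i =>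
    (hv.fderiv_right (m := 1) le_rfl).clm_apply contDiff_const
  rw [divergence_eq_sum_inner_fderiv (EuclideanSpace.basisFun (Fin 3) ℝ), (hasFDerivAt_viscFlux hv x).fderiv]
  have h1 : ∀ j : Fin 3, ⟪(EuclideanSpace.basisFun (Fin 3) ℝ) j, (∑ i : Fin 3,
      (fderiv ℝ (fun y => ⟪fderiv ℝ v y ((EuclideanSpace.basisFun (Fin 3) ℝ) i), v y⟫) x).smulRight ((EuclideanSpace.basisFun (Fin 3) ℝ) i)) ((EuclideanSpace.basisFun (Fin 3) ℝ) j)⟫ =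
      fderiv ℝ (fun y => ⟪fderiv ℝ v y ((EuclideanSpace.basisFun (Fin 3) ℝ) j), v y⟫) x ((EuclideanSpace.basisFun (Fin 3) ℝ) j) := by
    intro j
    simp only [FunLike.coe_sum, Finset.sum_apply, ContinuousLinearMap.smulRight_apply,
      inner_sum, real_inner_smul_right]
    have hij : ∀ i : Fin 3, ⟪(EuclideanSpace.basisFun (Fin 3) ℝ) j, (EuclideanSpace.basisFun (Fin 3) ℝ) i⟫ = if j = i then (1 : ℝ) else 0 := fun i => by
      rw [orthonormal_iff_ite.mp (EuclideanSpace.basisFun (Fin 3) ℝ).orthonormal]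
    simp_rw [hij, mul_ite, mul_one, mul_zero]
    simp
  simp_rw [h1]
  have hwd : DifferentiableAt ℝ v x := hv1.differentiable one_ne_zero x
  have hterm : ∀ i, fderiv ℝ (fun y => ⟪fderiv ℝ v y ((EuclideanSpace.basisFun (Fin 3) ℝ) i), v y⟫) x ((EuclideanSpace.basisFun (Fin 3) ℝ) i) =
      ⟪fderiv ℝ (fun y => fderiv ℝ v y ((EuclideanSpace.basisFun (Fin 3) ℝ) i)) x ((EuclideanSpace.basisFun (Fin 3) ℝ) i), v x⟫ + ⟪fderiv ℝ v x ((EuclideanSpace.basisFun (Fin 3) ℝ) i), fderiv ℝ v x ((EuclideanSpace.basisFun (Fin 3) ℝ) i)⟫ := by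
    intro i
    have hdi : DifferentiableAt ℝ (fun y => fderiv ℝ v y ((EuclideanSpace.basisFun (Fin 3) ℝ) i)) x := (hdw i).differentiable one_ne_zero x
    rw [fderiv_inner_apply ℝ hdi hwd]
    ring
  simp_rw [hterm, Finset.sum_add_distrib]
  congr 1
  · rw [laplacian_eq_sum_fderiv_fderiv (EuclideanSpace.basisFun (Fin 3) ℝ) hv x, sum_inner]
  · rw [frobeniusNormSq_eq_sum (EuclideanSpace.basisFun (Fin 3) ℝ)]
    exact Finset.sum_congr rfl fun i _ => real_inner_self_eq_norm_sq _

/-- The flux of a `z`-periodic field is `z`-periodic. [folklore] -/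
private theorem isAxiallyPeriodic_viscFlux {L : ℝ} {v : E3 → E3} (hper : IsAxiallyPeriodic L v) :
    IsAxiallyPeriodic L (fun y : E3 => ∑ i : Fin 3, ⟪fderiv ℝ v y ((EuclideanSpace.basisFun (Fin 3) ℝ) i), v y⟫ • (EuclideanSpace.basisFun (Fin 3) ℝ) i) := by
  intro y
  have hfun : (fun x => v (x + L • EuclideanSpace.single (2 : Fin 3) (1 : ℝ))) = v := funext hper
  have hD : fderiv ℝ v (y + L • EuclideanSpace.single (2 : Fin 3) (1 : ℝ)) = fderiv ℝ v y := by
    rw [← fderiv_comp_add_right, hfun]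
  simp only [hD, hper y]

/-- **The azimuthal vorticity in Cartesian terms**: `ω_φ = ⟪Dv e_z, e_r⟫ − ⟪Dv e_r, e_z⟫ = ∂_z v_r − ∂_r v_z`
(pure linear algebra on `Dv(x)`). [folklore] -/
private theorem swirlVelocity_curl_eq (v : E3 → E3) (x : E3) :
    swirlVelocity (curl v) x = ⟪fderiv ℝ v x eZ, eR x⟫ - ⟪fderiv ℝ v x (eR x), eZ⟫ := by
  have hR : eR x = (cylRadius x)⁻¹ •
      (x 0 • EuclideanSpace.single (0 : Fin 3) (1 : ℝ) + x 1 • EuclideanSpace.single (1 : Fin 3) (1 : ℝ)) := by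
    rw [eR, toLp_horizontal_eq_add_single]
  have hZ : eZ = EuclideanSpace.single (2 : Fin 3) (1 : ℝ) := rfl
  rw [hR, hZ]
  simp only [map_smul, map_add, swirlVelocity, curl, eTheta, PiLp.inner_apply, Fin.sum_univ_three,
    PiLp.smul_apply, PiLp.add_apply, PiLp.single_apply, RCLike.inner_apply, conj_trivial,
    smul_eq_mul]
  simp
  ring

/-- **A vector with vanishing radial and azimuthal components off the axis is axial**: `w = w_z e_z`. [folklore] -/
private theorem eq_smul_eZ_of_radial_swirl_zero {w x : E3} (hx : cylRadius x ≠ 0) (hr : ⟪w, eR x⟫ = 0)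
    (hθ : ⟪w, eTheta x⟫ = 0) : w = (w 2) • eZ := by
  have hr2 : 0 < x 0 ^ 2 + x 1 ^ 2 := by
    rw [← cylRadius_sq]
    exact pow_pos ((cylRadius_nonneg x).lt_of_ne' hx) 2
  have hinv : (cylRadius x)⁻¹ ≠ 0 := inv_ne_zero hx
  simp only [eR, eTheta, inner_smul_right, PiLp.inner_apply, Fin.sum_univ_three, RCLike.inner_apply,
    conj_trivial, mul_eq_zero, hinv, false_or] at hr hθ
  simp at hr hθ
  -- hr : x 0 * w 0 + x 1 * w 1 = 0 ; hθ : -(x 1) * w 0 + x 0 * w 1 = 0 (up to normal form)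
  have e0 : w 0 = 0 := by
    have : w 0 * (x 0 ^ 2 + x 1 ^ 2) = 0 := by linear_combination (x 0) * hr - (x 1) * hθ
    exact (mul_eq_zero.1 this).resolve_right hr2.ne'
  have e1 : w 1 = 0 := by
    have : w 1 * (x 0 ^ 2 + x 1 ^ 2) = 0 := by linear_combination (x 1) * hr + (x 0) * hθ
    exact (mul_eq_zero.1 this).resolve_right hr2.ne'
  ext i
  fin_cases i <;> simp [eZ, e0, e1]

/-- **On a wall `{r = R}` where `v_r ≡ 0`, `∂_z v_r = ⟪Dv e_z, e_r⟫ = 0`** (differentiate along the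
vertical line inside the wall). [folklore] -/
private theorem inner_fderiv_eZ_eR_eq_zero_of_wall {v : E3 → E3} {R : ℝ} (hv : Differentiable ℝ v) {x : E3}
    (hx : cylRadius x = R) (hwall : ∀ y : E3, cylRadius y = R → radialVelocity v y = 0) :
    ⟪fderiv ℝ v x eZ, eR x⟫ = 0 := by
  have hpt : ∀ s : ℝ, x + s • eZ = s • eZ + (1 : ℝ) • x := fun s => by rw [one_smul, add_comm]
  have hconst : ∀ s : ℝ, ⟪v (x + s • eZ), eR x⟫ = 0 := by
    intro s
    have h1 : cylRadius (x + s • eZ) = R := by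
      rw [hpt, cylRadius_smul_eZ_add_smul, abs_one, one_mul, hx]
    have h2 : eR (x + s • eZ) = eR x := by
      rw [hpt, eR_smul_eZ_add_smul s one_pos x]
    have := hwall _ h1
    rwa [radialVelocity, h2] at this
  have hd : HasDerivAt (fun s : ℝ => ⟪v (x + s • eZ), eR x⟫) ⟪fderiv ℝ v x eZ, eR x⟫ 0 := by
    have h1 : HasDerivAt (fun s : ℝ => x + s • eZ) eZ 0 := by
      simpa using ((hasDerivAt_id (0 : ℝ)).smul_const eZ).const_add x
    have h2 : HasFDerivAt v (fderiv ℝ v x) (x + (0 : ℝ) • eZ) := by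
      simpa using (hv x).hasFDerivAt
    have h3 : HasDerivAt (fun s : ℝ => v (x + s • eZ)) (fderiv ℝ v x eZ) 0 := h2.comp_hasDerivAt (0 : ℝ) h1
    have h4 := h3.inner ℝ (hasDerivAt_const (0 : ℝ) (eR x))
    simpa using h4
  have heq : (fun s : ℝ => ⟪v (x + s • eZ), eR x⟫) = fun _ => (0 : ℝ) := funext hconst
  have := hd.deriv
  rw [heq, deriv_const] at this
  exact this.symm

/-! ### §I.5 Lemma 2.2: the energy identity on the cell and the energy inequality (2.1) -/

/-- `|L|² ≥ 0`. [folklore] -/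
private theorem frobeniusNormSq_nonneg' (L : E3 →L[ℝ] E3) : 0 ≤ frobeniusNormSq L := by
  rw [frobeniusNormSq_eq_sum (EuclideanSpace.basisFun (Fin 3) ℝ)]
  exact Finset.sum_nonneg fun i _ => sq_nonneg _

/-- The divergence of a `C¹` field is continuous. [folklore] -/
private theorem continuous_divergence_of_contDiff {V : E3 → E3} (hV : ContDiff ℝ 1 V) :
    Continuous (VectorCalculus.divergence V) := by
  have h : VectorCalculus.divergence V = fun x => ∑ i : Fin 3, ⟪(EuclideanSpace.basisFun (Fin 3) ℝ) i, fderiv ℝ V x ((EuclideanSpace.basisFun (Fin 3) ℝ) i)⟫ :=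
    funext fun x => divergence_eq_sum_inner_fderiv (EuclideanSpace.basisFun (Fin 3) ℝ) V x
  rw [h]
  exact continuous_finsetSum _ fun i _ =>
    continuous_const.inner ((hV.continuous_fderiv one_ne_zero).clm_apply continuous_const)

/-- `x ↦ |Dw(x)|²` is continuous for `w ∈ C¹`. [folklore] -/
private theorem continuous_frobeniusNormSq_fderiv {w : E3 → E3} (hw : ContDiff ℝ 1 w) :
    Continuous fun x => frobeniusNormSq (fderiv ℝ w x) := by
  have h2 : (fun x => frobeniusNormSq (fderiv ℝ w x)) = fun x => ∑ i : Fin 3, ‖fderiv ℝ w x ((EuclideanSpace.basisFun (Fin 3) ℝ) i)‖ ^ 2 :=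
    funext fun x => frobeniusNormSq_eq_sum (EuclideanSpace.basisFun (Fin 3) ℝ) _
  rw [h2]
  exact continuous_finsetSum _ fun i _ => (((hw.continuous_fderiv one_ne_zero).clm_apply continuous_const).norm).pow 2

/-- `z ↦ |D(w z.1)(z.2)|²` is jointly continuous for `w` jointly `C^∞`. [folklore] -/
private theorem continuous_frobeniusNormSq_fderiv_slice {w : ℝ → E3 → E3} (hw : ContDiff ℝ ∞ (uncurry w)) :
    Continuous fun z : ℝ × E3 => frobeniusNormSq (fderiv ℝ (w z.1) z.2) := by
  have hu : ContDiffOn ℝ ∞ (uncurry w) ((univ : Set ℝ) ×ˢ (univ : Set E3)) := by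
    rw [univ_prod_univ]; exact hw.contDiffOn
  have key : ∀ z : ℝ × E3, fderiv ℝ (w z.1) z.2 =
      (fderiv ℝ (uncurry w) z).comp (ContinuousLinearMap.inr ℝ ℝ E3) := by
    intro z
    have h := fderiv_slice_of_contDiffOn hu (by simp) (mem_univ z.1) (mem_univ z.2) univ_mem
    rw [univ_prod_univ, fderivWithin_univ] at h
    exact h
  have hD : Continuous fun z : ℝ × E3 => fderiv ℝ (uncurry w) z := hw.continuous_fderiv (by simp)
  have h2 : (fun z : ℝ × E3 => frobeniusNormSq (fderiv ℝ (w z.1) z.2)) =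
      fun z => ∑ i : Fin 3, ‖(fderiv ℝ (uncurry w) z).comp (ContinuousLinearMap.inr ℝ ℝ E3) ((EuclideanSpace.basisFun (Fin 3) ℝ) i)‖ ^ 2 := by
    funext z
    rw [key z, frobeniusNormSq_eq_sum (EuclideanSpace.basisFun (Fin 3) ℝ)]
  rw [h2]
  exact continuous_finsetSum _ fun i _ =>
    (((hD.clm_comp continuous_const).clm_apply continuous_const).norm).pow 2

/-- A continuous function has finite `L^q` norm on the cell (every `q`). [folklore] -/
private theorem memLp_cell_of_continuous {R a : ℝ} {F : Type*} [NormedAddCommGroup F] {g : E3 → F} (hg : Continuous g)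
    (q : ℝ≥0∞) : MemLp g q (volume.restrict (cell R a)) :=
  ⟨hg.aestronglyMeasurable,
    eLpNorm_restrict_lt_top_of_continuousOn_isCompact (μ := volume) (isCompact_closure_cell R a)
      (Ω := ⟨cell R a, isOpen_cell R a⟩) subset_closure hg.continuousOn q⟩

/-- **Cauchy–Schwarz on the cell**: `∫ ⟪u, g⟫ ≤ √(∫|g|²) √(∫|u|²)` for continuous fields. [folklore] -/
private theorem setIntegral_inner_le_sqrt_mul_sqrt {R a : ℝ} {u g : E3 → E3} (hu : Continuous u) (hg : Continuous g) :
    ∫ x in cell R a, ⟪u x, g x⟫ ≤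
      Real.sqrt (∫ x in cell R a, ‖g x‖ ^ 2) * Real.sqrt (∫ x in cell R a, ‖u x‖ ^ 2) := by
  have h1 : ∫ x in cell R a, ⟪u x, g x⟫ ≤ ∫ x in cell R a, ‖g x‖ * ‖u x‖ := by
    refine integral_mono_ae (integrableOn_cell_of_continuous (hu.inner hg))
      (integrableOn_cell_of_continuous (hg.norm.mul hu.norm)) ?_
    exact Eventually.of_forall fun x => by
      show ⟪u x, g x⟫ ≤ ‖g x‖ * ‖u x‖
      rw [mul_comm]; exact real_inner_le_norm _ _
  refine h1.trans ?_
  have h2 := integral_mul_le_Lp_mul_Lq_of_nonneg (μ := volume.restrict (cell R a)) Real.HolderConjugate.two_two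
    (f := fun x => ‖g x‖) (g := fun x => ‖u x‖)
    (Eventually.of_forall fun x => norm_nonneg _) (Eventually.of_forall fun x => norm_nonneg _)
    (by simpa using memLp_cell_of_continuous (R := R) (a := a) hg.norm 2)
    (by simpa using memLp_cell_of_continuous (R := R) (a := a) hu.norm 2)
  simp only [Real.rpow_two] at h2
  rw [Real.sqrt_eq_rpow, Real.sqrt_eq_rpow]
  exact h2

section Energy

variable {R a ν T : ℝ} {f v : ℝ → E3 → E3} {p : ℝ → E3 → ℝ} {ψ₁ : ℝ → E3 → ℝ}

namespace IsSolution

/-- Velocity slices are `C^∞`. [folklore] -/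
private theorem contDiff_v (hS : IsSolution R a ν T f v p ψ₁) (t : ℝ) : ContDiff ℝ ∞ (v t) :=
  hS.smooth_v.comp (contDiff_prodMk_right t)

/-- Pressure slices are `C^∞`. [folklore] -/
private theorem contDiff_p (hS : IsSolution R a ν T f v p ψ₁) (t : ℝ) : ContDiff ℝ ∞ (p t) :=
  hS.smooth_p.comp (contDiff_prodMk_right t)

/-- Force slices are `C^∞`. [folklore] -/
private theorem contDiff_f (hS : IsSolution R a ν T f v p ψ₁) (t : ℝ) : ContDiff ℝ ∞ (f t) :=
  hS.smooth_f.comp (contDiff_prodMk_right t)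

set_option maxHeartbeats 400000 in
/-- **The energy production on the cell** (Lemma 2.2, the step `d/dt ½|v|² + ν|∇v|² = ∫ f·v`): for
`t ∈ [0,T)`, `∫_Ω 2⟪v, ∂ₜv⟫ = −2ν ∫_Ω |Dv|² + 2∫_Ω ⟪v, f⟫` — the pressure flux `2p v`, the transport flux
`|v|² v` and the viscous flux `W = ∇(½|v|²)` are `C¹`, `2a`-periodic and tangential on the wall (`v_r = 0`;
`v_φ = 0` and `ω_φ = 0` give `⟪W, e_r⟫ = v_z ∂_r v_z = 0`), so their divergences integrate to zero
(`setIntegral_divergence_cell_eq_zero`). [cite: Zajaczkowski2023, Lemma 2.2 p.8 l.34–68 (proof, first display)] -/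
theorem production_eq (hS : IsSolution R a ν T f v p ψ₁) {t : ℝ} (ht : t ∈ Ico 0 T) :
    ∫ x in cell R a, 2 * ⟪v t x, timeDerivWithin (Ico 0 T) v t x⟫ =
      -(2 * ν) * (∫ x in cell R a, frobeniusNormSq (fderiv ℝ (v t) x)) +
        2 * ∫ x in cell R a, ⟪v t x, f t x⟫ := by
  have hv : ContDiff ℝ 2 (v t) := (hS.contDiff_v t).of_le (by norm_cast)
  have hv1 : ContDiff ℝ 1 (v t) := hv.of_le one_le_two
  have hp1 : ContDiff ℝ 1 (p t) := (hS.contDiff_p t).of_le (by exact_mod_cast le_top)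
  have hfc : Continuous (f t) := (hS.contDiff_f t).continuous
  -- the two flux fields
  set G : E3 → E3 := fun y => ⟪v t y, v t y⟫ • v t y + (2 * p t y) • v t y with hG
  set W : E3 → E3 := fun y : E3 => ∑ i : Fin 3, ⟪fderiv ℝ (v t) y ((EuclideanSpace.basisFun (Fin 3) ℝ) i), v t y⟫ •
    (EuclideanSpace.basisFun (Fin 3) ℝ) i with hW
  have hGc : ContDiff ℝ 1 G := ((hv1.inner ℝ hv1).smul hv1).add ((contDiff_const.mul hp1).smul hv1)
  have hWc : ContDiff ℝ 1 W := contDiff_viscFlux hv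
  have hGper : IsAxiallyPeriodic (2 * a) G := fun y => by
    simp only [hG, (hS.periodic t).1 y, (hS.periodic t).2.1 y]
  have hWper : IsAxiallyPeriodic (2 * a) W := isAxiallyPeriodic_viscFlux (hS.periodic t).1
  have hGslip : ∀ x : E3, cylRadius x = R → ⟪G x, eR x⟫ = 0 := fun x hx => by
    have h := (hS.wall t ht x hx).1
    rw [radialVelocity] at h
    simp only [hG, inner_add_left, real_inner_smul_left, h, mul_zero, add_zero]
  have hWslip : ∀ x : E3, cylRadius x = R → ⟪W x, eR x⟫ = 0 := fun x hx => by
    obtain ⟨hr, hθ, hω, -⟩ := hS.wall t ht x hx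
    have hx0 : cylRadius x ≠ 0 := by rw [hx]; exact hS.R_pos.ne'
    have hvz : v t x = (v t x 2) • eZ := eq_smul_eZ_of_radial_swirl_zero hx0 hr hθ
    have hzr : ⟪fderiv ℝ (v t) x eZ, eR x⟫ = 0 :=
      inner_fderiv_eZ_eR_eq_zero_of_wall (hv1.differentiable one_ne_zero) hx
        (fun y hy => (hS.wall t ht y hy).1)
    have hrz : ⟪fderiv ℝ (v t) x (eR x), eZ⟫ = 0 := by
      have := swirlVelocity_curl_eq (v t) x
      rw [hzr, zero_sub] at this
      have hω' : swirlVelocity (curl (v t)) x = 0 := hω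
      linarith
    show ⟪∑ i : Fin 3, ⟪fderiv ℝ (v t) x ((EuclideanSpace.basisFun (Fin 3) ℝ) i), v t x⟫ •
      (EuclideanSpace.basisFun (Fin 3) ℝ) i, eR x⟫ = 0
    rw [inner_viscFlux, hvz, inner_smul_right, hrz, mul_zero]
  have hG0 : ∫ x in cell R a, VectorCalculus.divergence G x = 0 :=
    setIntegral_divergence_cell_eq_zero hS.R_pos hS.a_pos hGc hGslip hGper
  have hW0 : ∫ x in cell R a, VectorCalculus.divergence W x = 0 :=
    setIntegral_divergence_cell_eq_zero hS.R_pos hS.a_pos hWc hWslip hWper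
  -- the pointwise identity on the cell
  have hpt : ∀ x ∈ cell R a, 2 * ⟪v t x, timeDerivWithin (Ico 0 T) v t x⟫ =
      -VectorCalculus.divergence G x + (2 * ν) * VectorCalculus.divergence W x
        - (2 * ν) * frobeniusNormSq (fderiv ℝ (v t) x) + 2 * ⟪v t x, f t x⟫ := by
    intro x hx
    have hxU : x ∈ cylinder R := cell_subset_cylinder R a hx
    have da : DifferentiableAt ℝ (v t) x := hv1.differentiable one_ne_zero x
    have dP : DifferentiableAt ℝ (p t) x := hp1.differentiable one_ne_zero x
    have hm := hS.ns.momentum t ht x hxU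
    set a' : E3 → E3 := fun y => timeDerivWithin (Ico 0 T) v t y - ν • (Δ (v t)) y - f t y with ha'
    have ea : a' x = -gradient (p t) x - fderiv ℝ (v t) x (v t x) := by
      show timeDerivWithin (Ico 0 T) v t x - ν • (Δ (v t)) x - f t x = _
      rw [eq_sub_of_add_eq hm, convect_apply]
      abel
    have key := two_mul_inner_timeDeriv_eq_neg_divergence da dP ea (hS.ns.divFree t ht x hxU)
    rw [← hG] at key
    have hvisc : ⟪v t x, (Δ (v t)) x⟫ =
        VectorCalculus.divergence W x - frobeniusNormSq (fderiv ℝ (v t) x) := by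
      rw [hW, divergence_viscFlux hv x, real_inner_comm]
      ring
    have hsplit : 2 * ⟪v t x, timeDerivWithin (Ico 0 T) v t x⟫ =
        2 * ⟪v t x, a' x⟫ + (2 * ν) * ⟪v t x, (Δ (v t)) x⟫ + 2 * ⟪v t x, f t x⟫ := by
      rw [ha']
      simp only [inner_sub_right, real_inner_smul_right]
      ring
    rw [hsplit, key, hvisc]
    ring
  rw [setIntegral_congr_fun (measurableSet_cell R a) hpt]
  -- integrability of the four pieces
  have i1 : IntegrableOn (fun x => VectorCalculus.divergence G x) (cell R a) volume :=
    integrableOn_cell_of_continuous (continuous_divergence_of_contDiff hGc)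
  have i2 : IntegrableOn (fun x => VectorCalculus.divergence W x) (cell R a) volume :=
    integrableOn_cell_of_continuous (continuous_divergence_of_contDiff hWc)
  have i3 : IntegrableOn (fun x => frobeniusNormSq (fderiv ℝ (v t) x)) (cell R a) volume :=
    integrableOn_cell_of_continuous (continuous_frobeniusNormSq_fderiv hv1)
  have i4 : IntegrableOn (fun x => ⟪v t x, f t x⟫) (cell R a) volume :=
    integrableOn_cell_of_continuous (hv1.continuous.inner hfc)
  have e1 : ∫ x in cell R a, (-VectorCalculus.divergence G x + (2 * ν) * VectorCalculus.divergence W x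
      - (2 * ν) * frobeniusNormSq (fderiv ℝ (v t) x) + 2 * ⟪v t x, f t x⟫) =
      -(∫ x in cell R a, VectorCalculus.divergence G x) + (2 * ν) * (∫ x in cell R a, VectorCalculus.divergence W x)
        - (2 * ν) * (∫ x in cell R a, frobeniusNormSq (fderiv ℝ (v t) x)) + 2 * ∫ x in cell R a, ⟪v t x, f t x⟫ := by
    have j1 : IntegrableOn (fun x => -VectorCalculus.divergence G x) (cell R a) volume := i1.neg
    have j2 : IntegrableOn (fun x => (2 * ν) * VectorCalculus.divergence W x) (cell R a) volume :=
      i2.const_mul _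
    have j3 : IntegrableOn (fun x => (2 * ν) * frobeniusNormSq (fderiv ℝ (v t) x)) (cell R a) volume :=
      i3.const_mul _
    have j4 : IntegrableOn (fun x => 2 * ⟪v t x, f t x⟫) (cell R a) volume := i4.const_mul _
    have j12 : IntegrableOn (fun x => -VectorCalculus.divergence G x +
        (2 * ν) * VectorCalculus.divergence W x) (cell R a) volume := j1.add j2
    have j123 : IntegrableOn (fun x => -VectorCalculus.divergence G x +
        (2 * ν) * VectorCalculus.divergence W x - (2 * ν) * frobeniusNormSq (fderiv ℝ (v t) x))
        (cell R a) volume := j12.sub j3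
    rw [integral_add j123 j4, integral_sub j12 j3, integral_add j1 j2, integral_neg, integral_const_mul,
      integral_const_mul, integral_const_mul]
  rw [e1, hG0, hW0]
  ring

/-- The energy `e(s) = ∫_Ω |v(s)|²` is continuous in time. [folklore] -/
private theorem continuous_energy (hS : IsSolution R a ν T f v p ψ₁) :
    Continuous fun s => ∫ x in cell R a, ‖v s x‖ ^ 2 :=
  continuous_cellIntegral (G := fun s x => ‖v s x‖ ^ 2) ((hS.smooth_v.continuous.norm).pow 2)

/-- The dissipation `D(s) = ∫_Ω |Dv(s)|²` is continuous in time. [folklore] -/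
private theorem continuous_dissipation (hS : IsSolution R a ν T f v p ψ₁) :
    Continuous fun s => ∫ x in cell R a, frobeniusNormSq (fderiv ℝ (v s) x) :=
  continuous_cellIntegral (G := fun s x => frobeniusNormSq (fderiv ℝ (v s) x))
    (continuous_frobeniusNormSq_fderiv_slice hS.smooth_v)

/-- The power `P(s) = ∫_Ω ⟪v(s), f(s)⟫` is continuous in time. [folklore] -/
private theorem continuous_power (hS : IsSolution R a ν T f v p ψ₁) :
    Continuous fun s => ∫ x in cell R a, ⟪v s x, f s x⟫ :=
  continuous_cellIntegral (G := fun s x => ⟪v s x, f s x⟫)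
    (hS.smooth_v.continuous.inner hS.smooth_f.continuous)

/-- The force norm `N(s) = ∫_Ω |f(s)|²` is continuous in time. [folklore] -/
private theorem continuous_forceSq (hS : IsSolution R a ν T f v p ψ₁) :
    Continuous fun s => ∫ x in cell R a, ‖f s x‖ ^ 2 :=
  continuous_cellIntegral (G := fun s x => ‖f s x‖ ^ 2) ((hS.smooth_f.continuous.norm).pow 2)

/-- **Differentiation of the energy under the integral sign**: for `s ∈ (0, T)`,
`d/ds ∫_Ω |v(s)|² = −2ν ∫_Ω |Dv(s)|² + 2 ∫_Ω ⟪v(s), f(s)⟫` (the integrand `2⟪v, ∂ₜv⟫` is jointly continuous,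
hence dominated on `[0, T'] × closure Ω`; then `production_eq`). [cite: Zajaczkowski2023, Lemma 2.2 p.8 (proof)] -/
theorem hasDerivAt_energy (hS : IsSolution R a ν T f v p ψ₁) {s : ℝ} (hs : s ∈ Ioo 0 T) :
    HasDerivAt (fun σ => ∫ x in cell R a, ‖v σ x‖ ^ 2)
      (-(2 * ν) * (∫ x in cell R a, frobeniusNormSq (fderiv ℝ (v s) x)) +
        2 * ∫ x in cell R a, ⟪v s x, f s x⟫) s := by
  set S : Set ℝ := Ico 0 T with hS_def
  have hSud : UniqueDiffOn ℝ S := uniqueDiffOn_Ico 0 T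
  set T' : ℝ := (s + T) / 2 with hT'_def
  have hsT' : s < T' := by rw [hT'_def]; linarith [hs.2]
  have hT'T : T' < T := by rw [hT'_def]; linarith [hs.2]
  have hIccS : Icc 0 T' ⊆ S := fun σ hσ => ⟨hσ.1, hσ.2.trans_lt hT'T⟩
  have hIooS : Ioo 0 T' ⊆ S := fun σ hσ => ⟨hσ.1.le, hσ.2.trans hT'T⟩
  have hSnhds : ∀ σ ∈ Ioo 0 T', S ∈ 𝓝 σ := fun σ hσ =>
    mem_of_superset (Ioo_mem_nhds hσ.1 (hσ.2.trans hT'T)) Ioo_subset_Ico_self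
  have hu : ContDiffOn ℝ 1 (uncurry v) (S ×ˢ (univ : Set E3)) :=
    (hS.smooth_v.of_le (by exact_mod_cast le_top)).contDiffOn
  have cu : Continuous (uncurry v) := hS.smooth_v.continuous
  have cu' : ContinuousOn (uncurry (timeDerivWithin S v)) (S ×ˢ (univ : Set E3)) :=
    continuousOn_uncurry_timeDerivWithin hu le_rfl hSud uniqueDiffOn_univ
  set Ω : Set E3 := cell R a with hΩ_def
  have hQc : IsCompact (Icc (0 : ℝ) T' ×ˢ closure Ω) := isCompact_Icc.prod (isCompact_closure_cell R a)
  have hQsub : Icc (0 : ℝ) T' ×ˢ closure Ω ⊆ S ×ˢ (univ : Set E3) := prod_mono hIccS (subset_univ _)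
  have cF' : ContinuousOn (fun z : ℝ × E3 => 2 * ⟪v z.1 z.2, timeDerivWithin S v z.1 z.2⟫)
      (Icc 0 T' ×ˢ closure Ω) :=
    continuousOn_const.mul ((cu.continuousOn.mono hQsub).inner (cu'.mono hQsub))
  obtain ⟨C₁, hC₁⟩ := hQc.exists_bound_of_continuousOn cF'
  have hΩmeas : MeasurableSet Ω := measurableSet_cell R a
  have hΩfin : volume Ω ≠ ⊤ := (volume_cell_lt_top R a).ne
  have hmemΩ : ∀ᵐ x ∂(volume.restrict Ω), x ∈ closure Ω :=
    (ae_restrict_mem hΩmeas).mono fun x hx => subset_closure hx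
  have hIoo : Ioo 0 T' ∈ 𝓝 s := Ioo_mem_nhds hs.1 hsT'
  have hsI : s ∈ Icc 0 T' := ⟨hs.1.le, hsT'.le⟩
  have cFs : ∀ σ : ℝ, Continuous fun x => ‖v σ x‖ ^ 2 := fun σ =>
    ((hS.contDiff_v σ).continuous.norm).pow 2
  have cF's : ∀ σ ∈ Icc (0 : ℝ) T',
      ContinuousOn (fun x => 2 * ⟪v σ x, timeDerivWithin S v σ x⟫) (closure Ω) := fun σ hσ =>
    cF'.comp (f := fun x : E3 => ((σ, x) : ℝ × E3)) (Continuous.prodMk_right σ).continuousOn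
      fun x hx => ⟨hσ, hx⟩
  have key := hasDerivAt_integral_of_dominated_loc_of_deriv_le (μ := volume.restrict Ω)
    (F := fun σ x => ‖v σ x‖ ^ 2)
    (F' := fun σ x => 2 * ⟪v σ x, timeDerivWithin S v σ x⟫) (x₀ := s)
    (bound := fun _ => C₁) hIoo ?_ (integrableOn_cell_of_continuous (cFs s))
    (((cF's s hsI).mono subset_closure).aestronglyMeasurable hΩmeas) ?_
    (integrableOn_const hΩfin) ?_
  · have h2 := key.2
    rw [hS.production_eq (hIooS ⟨hs.1, hsT'⟩)] at h2
    exact h2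
  · exact Eventually.of_forall fun σ => (cFs σ).aestronglyMeasurable
  · exact hmemΩ.mono fun x hx σ hσ => hC₁ (σ, x) ⟨Ioo_subset_Icc_self hσ, hx⟩
  · refine hmemΩ.mono fun x _ σ hσ => ?_
    have hσS : σ ∈ S := hIooS hσ
    exact (hasDerivAt_time_of_contDiffOn hu one_ne_zero hSud hσS (hSnhds σ hσ) (mem_univ x)).norm_sq

/-- **The energy identity on the period cell** (Lemma 2.2, integrated form): for `τ ∈ [0, T)`,
`∫_Ω |v(τ)|² − ∫_Ω |v(0)|² = ∫₀^τ (−2ν ∫_Ω |Dv|² + 2 ∫_Ω ⟪v, f⟫) dσ`.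
[cite: Zajaczkowski2023, Lemma 2.2 (2.1) p.8 l.34–68] -/
theorem energy_identity (hS : IsSolution R a ν T f v p ψ₁) {τ : ℝ} (hτ : τ ∈ Ico 0 T) :
    (∫ x in cell R a, ‖v τ x‖ ^ 2) - (∫ x in cell R a, ‖v 0 x‖ ^ 2) =
      ∫ σ in (0 : ℝ)..τ, (-(2 * ν) * (∫ x in cell R a, frobeniusNormSq (fderiv ℝ (v σ) x)) +
        2 * ∫ x in cell R a, ⟪v σ x, f σ x⟫) := by
  have hcont := hS.continuous_energy
  have hg : Continuous fun σ => -(2 * ν) * (∫ x in cell R a, frobeniusNormSq (fderiv ℝ (v σ) x)) +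
      2 * ∫ x in cell R a, ⟪v σ x, f σ x⟫ :=
    (continuous_const.mul hS.continuous_dissipation).add (continuous_const.mul hS.continuous_power)
  rw [intervalIntegral.integral_eq_sub_of_hasDerivAt_of_le hτ.1 hcont.continuousOn
    (fun σ hσ => hS.hasDerivAt_energy ⟨hσ.1, hσ.2.trans hτ.2⟩) (hg.intervalIntegrable _ _)]

/-- `√(a + b) ≤ √a + √b`. [folklore] -/
private theorem sqrt_add_le' {x y : ℝ} (hx : 0 ≤ x) (hy : 0 ≤ y) : Real.sqrt (x + y) ≤ Real.sqrt x + Real.sqrt y := by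
  rw [Real.sqrt_le_iff]
  refine ⟨by positivity, ?_⟩
  nlinarith [Real.sq_sqrt hx, Real.sq_sqrt hy, Real.sqrt_nonneg x, Real.sqrt_nonneg y]

/-- **Lemma 2.2 (2.1), real form** — for `0 < s`, `s ≤ t`, `s < T`:
`∫_Ω|v(s)|² + ν ∫₀ˢ ∫_Ω |Dv|² ≤ 3 (∫₀ᵗ ‖f‖_{L²(Ω)})² + 2 ∫_Ω|v(0)|²`. From the energy identity,
Cauchy–Schwarz `∫⟪v,f⟫ ≤ ‖f‖₂ ‖v‖₂` and the `√`-Grönwall step `‖v(σ)‖₂ ≤ ‖v(0)‖₂ + ∫₀^σ ‖f‖₂`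
(monotonicity of `√(E + δ) − ∫‖f‖₂`), then `2I‖v₀‖ ≤ I² + ‖v₀‖²`. [cite: Zajaczkowski2023, Lemma 2.2 (2.1) p.8 l.34–68] -/
theorem energy_ineq_real (hS : IsSolution R a ν T f v p ψ₁) {s t : ℝ} (hs0 : 0 < s) (hst : s ≤ t) (hsT : s < T) :
    (∫ x in cell R a, ‖v s x‖ ^ 2) +
        ν * ∫ σ in (0 : ℝ)..s, ∫ x in cell R a, frobeniusNormSq (fderiv ℝ (v σ) x) ≤
      3 * (∫ σ in (0 : ℝ)..t, Real.sqrt (∫ x in cell R a, ‖f σ x‖ ^ 2)) ^ 2 +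
        2 * ∫ x in cell R a, ‖v 0 x‖ ^ 2 := by
  -- notation
  set e : ℝ → ℝ := fun σ => ∫ x in cell R a, ‖v σ x‖ ^ 2 with he
  set D : ℝ → ℝ := fun σ => ∫ x in cell R a, frobeniusNormSq (fderiv ℝ (v σ) x) with hD
  set P : ℝ → ℝ := fun σ => ∫ x in cell R a, ⟪v σ x, f σ x⟫ with hP
  set F : ℝ → ℝ := fun σ => Real.sqrt (∫ x in cell R a, ‖f σ x‖ ^ 2) with hF
  have hν : 0 < ν := hS.ν_pos
  have ce : Continuous e := hS.continuous_energy
  have cD : Continuous D := hS.continuous_dissipation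
  have cP : Continuous P := hS.continuous_power
  have cF : Continuous F := hS.continuous_forceSq.sqrt
  have e0 : ∀ σ, 0 ≤ e σ := fun σ => integral_nonneg fun x => sq_nonneg _
  have D0 : ∀ σ, 0 ≤ D σ := fun σ => integral_nonneg fun x => frobeniusNormSq_nonneg' _
  have F0 : ∀ σ, 0 ≤ F σ := fun σ => Real.sqrt_nonneg _
  have hPF : ∀ σ, P σ ≤ F σ * Real.sqrt (e σ) := fun σ =>
    setIntegral_inner_le_sqrt_mul_sqrt (hS.contDiff_v σ).continuous (hS.contDiff_f σ).continuous
  -- primitives of `D` and `F`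
  set ID : ℝ → ℝ := fun σ => ∫ τ in (0 : ℝ)..σ, D τ with hID
  set IF : ℝ → ℝ := fun σ => ∫ τ in (0 : ℝ)..σ, F τ with hIF
  have hIDd : ∀ σ, HasDerivAt ID (D σ) σ := fun σ => (cD.integral_hasStrictDerivAt 0 σ).hasDerivAt
  have hIFd : ∀ σ, HasDerivAt IF (F σ) σ := fun σ => (cF.integral_hasStrictDerivAt 0 σ).hasDerivAt
  have cID : Continuous ID := continuous_iff_continuousAt.2 fun σ => (hIDd σ).continuousAt
  have cIF : Continuous IF := continuous_iff_continuousAt.2 fun σ => (hIFd σ).continuousAt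
  have ID0 : ∀ σ, 0 ≤ σ → 0 ≤ ID σ := fun σ hσ => intervalIntegral.integral_nonneg hσ fun τ _ => D0 τ
  have IFmono : ∀ σ σ', 0 ≤ σ → σ ≤ σ' → IF σ ≤ IF σ' := fun σ σ' hσ hσσ' =>
    intervalIntegral.integral_mono_interval le_rfl hσ hσσ'
      (Eventually.of_forall fun τ => F0 τ) (cF.intervalIntegrable _ _)
  have IF0 : ∀ σ, 0 ≤ σ → 0 ≤ IF σ := fun σ hσ => intervalIntegral.integral_nonneg hσ fun τ _ => F0 τ
  have hID0 : ID 0 = 0 := intervalIntegral.integral_same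
  have hIF0 : IF 0 = 0 := intervalIntegral.integral_same
  -- `y = e + 2ν ID` has derivative `2P` on `(0, T)`
  have hy : ∀ σ ∈ Ioo 0 T, HasDerivAt (fun σ => e σ + 2 * ν * ID σ) (2 * P σ) σ := by
    intro σ hσ
    have h := (hS.hasDerivAt_energy hσ).add ((hIDd σ).const_mul (2 * ν))
    have hfun : (fun σ => e σ + 2 * ν * ID σ) =
        ((fun σ => ∫ x in cell R a, ‖v σ x‖ ^ 2) + fun y => 2 * ν * ID y) := rfl
    rw [hfun]
    refine h.congr_deriv ?_
    show -(2 * ν) * D σ + 2 * P σ + 2 * ν * D σ = 2 * P σ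
    ring
  -- the `√`-Grönwall step on `[0, T']`
  set T' : ℝ := (s + T) / 2 with hT'_def
  have hsT' : s < T' := by rw [hT'_def]; linarith
  have hT'T : T' < T := by rw [hT'_def]; linarith
  have hsqrt : ∀ σ ∈ Icc (0 : ℝ) T', Real.sqrt (e σ) ≤ Real.sqrt (e 0) + IF σ := by
    intro σ hσ
    refine le_of_forall_pos_le_add fun ε hε => ?_
    set δ : ℝ := ε ^ 2 with hδ
    have hδpos : 0 < δ := by positivity
    set g : ℝ → ℝ := fun τ => Real.sqrt (e τ + 2 * ν * ID τ + δ) - IF τ with hg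
    have Ypos : ∀ τ, 0 ≤ τ → 0 < e τ + 2 * ν * ID τ + δ := fun τ hτ => by
      have := e0 τ; have := ID0 τ hτ; positivity
    have hgd : ∀ τ ∈ Ioo (0 : ℝ) T', HasDerivAt g
        (2 * P τ / (2 * Real.sqrt (e τ + 2 * ν * ID τ + δ)) - F τ) τ := by
      intro τ hτ
      have h1 := ((hy τ ⟨hτ.1, hτ.2.trans hT'T⟩).add_const δ).sqrt (Ypos τ hτ.1.le).ne'
      exact h1.sub (hIFd τ)
    have hgc : Continuous g := (((ce.add (continuous_const.mul cID)).add continuous_const).sqrt).sub cIF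
    have hanti : AntitoneOn g (Icc 0 T') := by
      refine antitoneOn_of_deriv_nonpos (convex_Icc 0 T') hgc.continuousOn ?_ ?_
      · rw [interior_Icc]
        exact fun τ hτ => (hgd τ hτ).differentiableAt.differentiableWithinAt
      · rw [interior_Icc]
        intro τ hτ
        rw [(hgd τ hτ).deriv, sub_nonpos, div_le_iff₀ (by have := Ypos τ hτ.1.le; positivity)]
        have h1 : Real.sqrt (e τ) ≤ Real.sqrt (e τ + 2 * ν * ID τ + δ) :=
          Real.sqrt_le_sqrt (by have := ID0 τ hτ.1.le; nlinarith)
        have h2 := hPF τ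
        have h3 := F0 τ
        nlinarith
    have hg0 : g σ ≤ g 0 := hanti (left_mem_Icc.2 (hσ.1.trans hσ.2)) hσ hσ.1
    have hg0' : g 0 = Real.sqrt (e 0 + δ) := by
      simp only [hg, hID0, hIF0, mul_zero, add_zero, sub_zero]
    rw [hg0'] at hg0
    have h1 : Real.sqrt (e σ) ≤ Real.sqrt (e σ + 2 * ν * ID σ + δ) :=
      Real.sqrt_le_sqrt (by have := ID0 σ hσ.1; nlinarith)
    have h2 : Real.sqrt (e 0 + δ) ≤ Real.sqrt (e 0) + Real.sqrt δ := sqrt_add_le' (e0 0) hδpos.le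
    have h3 : Real.sqrt δ = ε := by rw [hδ]; exact Real.sqrt_sq hε.le
    have h4 : g σ = Real.sqrt (e σ + 2 * ν * ID σ + δ) - IF σ := rfl
    linarith
  -- assembly at time `s`
  set I : ℝ := IF t with hI
  have hI0 : 0 ≤ I := IF0 t (hs0.le.trans hst)
  have hsplit : e s - e 0 = -(2 * ν) * ID s + 2 * ∫ σ in (0 : ℝ)..s, P σ := by
    have h := hS.energy_identity ⟨hs0.le, hsT⟩
    have i1 : IntervalIntegrable (fun σ => -(2 * ν) * ∫ x in cell R a, frobeniusNormSq (fderiv ℝ (v σ) x))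
        volume 0 s := (continuous_const.mul cD).intervalIntegrable _ _
    have i2 : IntervalIntegrable (fun σ => 2 * ∫ x in cell R a, ⟪v σ x, f σ x⟫) volume 0 s :=
      (continuous_const.mul cP).intervalIntegrable _ _
    rw [intervalIntegral.integral_add i1 i2, intervalIntegral.integral_const_mul,
      intervalIntegral.integral_const_mul] at h
    exact h
  have hPint : ∫ σ in (0 : ℝ)..s, P σ ≤ I * (Real.sqrt (e 0) + I) := by
    have h1 : ∫ σ in (0 : ℝ)..s, P σ ≤ ∫ σ in (0 : ℝ)..s, F σ * (Real.sqrt (e 0) + I) := by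
      refine intervalIntegral.integral_mono_on hs0.le (cP.intervalIntegrable _ _)
        ((cF.mul continuous_const).intervalIntegrable _ _) fun σ hσ => ?_
      have hσT' : σ ∈ Icc (0 : ℝ) T' := ⟨hσ.1, hσ.2.trans hsT'.le⟩
      have h2 : Real.sqrt (e σ) ≤ Real.sqrt (e 0) + I :=
        (hsqrt σ hσT').trans (by linarith [IFmono σ t hσ.1 (hσ.2.trans hst)])
      calc P σ ≤ F σ * Real.sqrt (e σ) := hPF σ
        _ ≤ F σ * (Real.sqrt (e 0) + I) := mul_le_mul_of_nonneg_left h2 (F0 σ)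
    rw [intervalIntegral.integral_mul_const] at h1
    have h2 : IF s ≤ I := IFmono s t hs0.le hst
    have h3 : 0 ≤ Real.sqrt (e 0) + I := by positivity
    calc ∫ σ in (0 : ℝ)..s, P σ ≤ IF s * (Real.sqrt (e 0) + I) := h1
      _ ≤ I * (Real.sqrt (e 0) + I) := mul_le_mul_of_nonneg_right h2 h3
  have hsq0 : Real.sqrt (e 0) ^ 2 = e 0 := Real.sq_sqrt (e0 0)
  have hIDs : 0 ≤ ID s := ID0 s hs0.le
  have key : e s + 2 * ν * ID s ≤ 2 * e 0 + 3 * I ^ 2 := by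
    nlinarith [sq_nonneg (I - Real.sqrt (e 0)), Real.sqrt_nonneg (e 0)]
  show e s + ν * ID s ≤ 3 * I ^ 2 + 2 * e 0
  nlinarith

/-- `‖g‖_{L²(Ω)} = √(∫_Ω |g|²)` (as an `ℝ≥0∞` identity) for continuous `g`. [folklore] -/
private theorem Lp_two_norm_eq {R a : ℝ} {g : E3 → E3} (hg : Continuous g) :
    Lp R a 2 (fun x => ‖g x‖) = ENNReal.ofReal (Real.sqrt (∫ x in cell R a, ‖g x‖ ^ 2)) := by
  have hmem : MemLp (fun x => ‖g x‖) 2 (volume.restrict (cell R a)) := memLp_cell_of_continuous hg.norm 2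
  rw [Lp, μΩ, hmem.eLpNorm_eq_integral_rpow_norm two_ne_zero ENNReal.ofNat_ne_top]
  congr 1
  simp only [norm_norm, ENNReal.toReal_ofNat, Real.rpow_two]
  rw [Real.sqrt_eq_rpow, one_div]

/-- **Lemma 2.2, inequality (2.1) as typed** (first conjunct of `Ineq21_27`). [cite: Zajaczkowski2023, Lemma 2.2 (2.1) p.8 l.34–68] -/
theorem ineq21 (hS : IsSolution R a ν T f v p ψ₁) {t : ℝ} (ht : t ∈ Ioc 0 T) {s : ℝ} (hs : s ∈ Ioo 0 t) :
    Lp R a 2 (fun x => ‖v s x‖) ^ 2 +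
        ENNReal.ofReal ν * ∫⁻ τ in Ioo 0 s, ∫⁻ x in cell R a,
          ENNReal.ofReal (frobeniusNormSq (fderiv ℝ (v τ) x)) ≤
      3 * Lpq R a 2 1 t (fun τ x => ‖f τ x‖) ^ 2 + 2 * Lp R a 2 (fun x => ‖v 0 x‖) ^ 2 := by
  have hν : 0 < ν := hS.ν_pos
  have hsT : s < T := hs.2.trans_le ht.2
  -- notation (real quantities)
  set e : ℝ → ℝ := fun σ => ∫ x in cell R a, ‖v σ x‖ ^ 2 with he
  set D : ℝ → ℝ := fun σ => ∫ x in cell R a, frobeniusNormSq (fderiv ℝ (v σ) x) with hD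
  set F : ℝ → ℝ := fun σ => Real.sqrt (∫ x in cell R a, ‖f σ x‖ ^ 2) with hF
  have cD : Continuous D := hS.continuous_dissipation
  have cF : Continuous F := hS.continuous_forceSq.sqrt
  have e0 : ∀ σ, 0 ≤ e σ := fun σ => integral_nonneg fun x => sq_nonneg _
  have D0 : ∀ σ, 0 ≤ D σ := fun σ => integral_nonneg fun x => frobeniusNormSq_nonneg' _
  have F0 : ∀ σ, 0 ≤ F σ := fun σ => Real.sqrt_nonneg _
  have hreal := hS.energy_ineq_real hs.1 hs.2.le hsT
  -- (a) the `L²` norms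
  have hLp : ∀ σ, Lp R a 2 (fun x => ‖v σ x‖) ^ 2 = ENNReal.ofReal (e σ) := fun σ => by
    rw [Lp_two_norm_eq (hS.contDiff_v σ).continuous, ← ENNReal.ofReal_pow (Real.sqrt_nonneg _),
      Real.sq_sqrt (e0 σ)]
  -- (b) the dissipation
  have hDin : ∀ τ, ∫⁻ x in cell R a, ENNReal.ofReal (frobeniusNormSq (fderiv ℝ (v τ) x)) =
      ENNReal.ofReal (D τ) := fun τ => by
    rw [hD]
    exact (ofReal_integral_eq_lintegral_ofReal
      (integrableOn_cell_of_continuous (continuous_frobeniusNormSq_fderiv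
        ((hS.contDiff_v τ).of_le (by exact_mod_cast le_top))))
      (Eventually.of_forall fun x => frobeniusNormSq_nonneg' _)).symm
  have hDout : ∫⁻ τ in Ioo 0 s, ∫⁻ x in cell R a, ENNReal.ofReal (frobeniusNormSq (fderiv ℝ (v τ) x)) =
      ENNReal.ofReal (∫ σ in (0 : ℝ)..s, D σ) := by
    simp_rw [hDin]
    rw [← ofReal_integral_eq_lintegral_ofReal (cD.integrableOn_Icc.mono_set Ioo_subset_Icc_self)
      (Eventually.of_forall fun τ => D0 τ), intervalIntegral.integral_of_le hs.1.le,
      integral_Ioc_eq_integral_Ioo]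
  -- (c) the force term
  have hLpq : Lpq R a 2 1 t (fun τ x => ‖f τ x‖) = ENNReal.ofReal (∫ σ in (0 : ℝ)..t, F σ) := by
    rw [Lpq]
    simp only [ENNReal.rpow_one, div_one]
    have h1 : ∀ τ, Lp R a 2 (fun x => ‖f τ x‖) = ENNReal.ofReal (F τ) := fun τ =>
      Lp_two_norm_eq (hS.contDiff_f τ).continuous
    simp_rw [h1]
    rw [← ofReal_integral_eq_lintegral_ofReal (cF.integrableOn_Icc.mono_set Ioo_subset_Icc_self)
      (Eventually.of_forall fun τ => F0 τ), intervalIntegral.integral_of_le ht.1.le,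
      integral_Ioc_eq_integral_Ioo]
  -- assemble
  rw [hLp s, hLp 0, hDout, hLpq, ← ENNReal.ofReal_mul hν.le,
    ← ENNReal.ofReal_add (e0 s) (mul_nonneg hν.le (intervalIntegral.integral_nonneg hs.1.le fun τ _ => D0 τ)),
    ← ENNReal.ofReal_pow (intervalIntegral.integral_nonneg ht.1.le fun τ _ => F0 τ),
    ← ENNReal.ofReal_ofNat 3, ← ENNReal.ofReal_ofNat 2, ← ENNReal.ofReal_mul (by norm_num),
    ← ENNReal.ofReal_mul (by norm_num), ← ENNReal.ofReal_add (by positivity) (by have := e0 0; positivity)]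
  exact ENNReal.ofReal_le_ofReal hreal

end IsSolution

end Energy

/-! ### §I.6 Lemma 2.3: the swirl equation in the cylinder and uniform bounds by periodicity -/

section SwirlMax

variable {R a ν T : ℝ} {f v : ℝ → E3 → E3} {p : ℝ → E3 → ℝ} {ψ₁ : ℝ → E3 → ℝ}

/-- The swirl `x₀w₁ − x₁w₀` of a `z`-periodic field is `z`-periodic. [folklore] -/
private theorem isAxiallyPeriodic_swirl {L : ℝ} {w : E3 → E3} (hw : IsAxiallyPeriodic L w) :
    IsAxiallyPeriodic L (swirl w) := by
  intro x
  simp only [swirl, hw x, PiLp.add_apply, PiLp.smul_apply, PiLp.single_apply]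
  simp

/-- Axial translations do not change the radius. [folklore] -/
private theorem cylRadius_add_smul_single_two (x : E3) (c : ℝ) :
    cylRadius (x + c • EuclideanSpace.single (2 : Fin 3) (1 : ℝ)) = cylRadius x := by
  simp [cylRadius]

/-- Every point has an axial translate by an integer multiple of the period `2a` with height in
`[−a, a]`. [folklore] -/
private theorem exists_int_shift_mem_Icc {a : ℝ} (ha : 0 < a) (x : E3) :
    ∃ k : ℤ, (x + ((k : ℝ) * (2 * a)) • EuclideanSpace.single (2 : Fin 3) (1 : ℝ)) 2 ∈ Icc (-a) a := by
  refine ⟨-⌊(x 2 + a) / (2 * a)⌋, ?_⟩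
  have h2a : 0 < 2 * a := by positivity
  have hfl : (⌊(x 2 + a) / (2 * a)⌋ : ℝ) * (2 * a) ≤ x 2 + a :=
    (le_div_iff₀ h2a).1 (Int.floor_le _)
  have hlt : x 2 + a < ((⌊(x 2 + a) / (2 * a)⌋ : ℝ) + 1) * (2 * a) :=
    (div_lt_iff₀ h2a).1 (Int.lt_floor_add_one _)
  simp only [PiLp.add_apply, PiLp.smul_apply, PiLp.single_apply, if_true, smul_eq_mul, mul_one,
    Int.cast_neg, mem_Icc]
  constructor <;> nlinarith

/-- **Uniform bounds by periodicity**: a jointly continuous family of `2a`-periodic fields is bounded on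
`[0, s] × {r ≤ R}` (all heights `z`), by its maximum over one closed period cell. [folklore] -/
private theorem exists_bound_of_periodic {F : Type*} [NormedAddCommGroup F] {g : ℝ → E3 → F} {a : ℝ} (ha : 0 < a)
    (hg : Continuous (uncurry g)) (hper : ∀ τ, IsAxiallyPeriodic (2 * a) (g τ)) (s R : ℝ) :
    ∃ C : ℝ, 0 ≤ C ∧ ∀ τ ∈ Icc 0 s, ∀ x : E3, cylRadius x ≤ R → ‖g τ x‖ ≤ C := by
  obtain ⟨C, hC⟩ := (isCompact_Icc.prod (isCompact_closedCell R a)).exists_bound_of_continuousOn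
    (f := uncurry g) hg.continuousOn (s := Icc (0 : ℝ) s ×ˢ {x : E3 | cylRadius x ≤ R ∧ x 2 ∈ Icc (-a) a})
  refine ⟨max C 0, le_max_right _ _, fun τ hτ x hx => ?_⟩
  obtain ⟨k, hk⟩ := exists_int_shift_mem_Icc ha x
  have hper' := (hper τ).add_int_mul k x
  rw [← hper']
  refine (hC (τ, _) ⟨hτ, ?_, hk⟩).trans (le_max_left _ _)
  rw [cylRadius_add_smul_single_two]
  exact hx

/-- The closed period cell lies in the closure of the open one (`R, a > 0`): `x = lim_{c ↑ 1} c • x`.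
[folklore] -/
private theorem closedCell_subset_closure_cell (hR : 0 < R) (ha : 0 < a) :
    {x : E3 | cylRadius x ≤ R ∧ x 2 ∈ Icc (-a) a} ⊆ closure (cell R a) := by
  intro x hx
  obtain ⟨hr, hz1, hz2⟩ := hx
  have ht : Tendsto (fun c : ℝ => c • x) (𝓝[<] 1) (𝓝 x) := by
    have : Tendsto (fun c : ℝ => c • x) (𝓝 1) (𝓝 ((1 : ℝ) • x)) := tendsto_id.smul tendsto_const_nhds
    rw [one_smul] at this
    exact this.mono_left nhdsWithin_le_nhds
  refine mem_closure_of_tendsto ht ?_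
  filter_upwards [Ioo_mem_nhdsLT one_pos] with c hc
  refine ⟨?_, ?_, ?_⟩
  · rw [cylRadius_smul, abs_of_pos hc.1]
    calc c * cylRadius x ≤ c * R := mul_le_mul_of_nonneg_left hr hc.1.le
      _ < 1 * R := mul_lt_mul_of_pos_right hc.2 hR
      _ = R := one_mul R
  · simp only [PiLp.smul_apply, smul_eq_mul]; nlinarith [hc.1, hc.2]
  · simp only [PiLp.smul_apply, smul_eq_mul]; nlinarith [hc.1, hc.2]

/-- **A continuous function is bounded by its essential supremum on the closure of an open set**: if
`g ≤ m` a.e. on the open `U` then `g ≤ m` on `closure U`. [folklore] -/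
private theorem le_of_ae_le_of_mem_closure {U : Set E3} (hU : IsOpen U) {g : E3 → ℝ} (hg : Continuous g) {m : ℝ}
    (hae : ∀ᵐ y ∂(volume.restrict U), g y ≤ m) {x : E3} (hx : x ∈ closure U) : g x ≤ m := by
  by_contra h
  push Not at h
  set O : Set E3 := {y | m < g y} with hO
  have hOo : IsOpen O := isOpen_lt continuous_const hg
  have hxO : x ∈ O := h
  obtain ⟨y, hyO, hyU⟩ : (O ∩ U).Nonempty := by
    rw [mem_closure_iff] at hx
    exact hx O hOo hxO
  have hpos : 0 < volume (O ∩ U) := (hOo.inter hU).measure_pos volume ⟨y, hyO, hyU⟩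
  have hno : ∀ᵐ y ∂(volume.restrict U), y ∉ O := hae.mono fun y hy hyO => (not_le.2 hyO) hy
  have h0 := ae_iff.1 hno
  simp only [not_not, setOf_mem_eq] at h0
  rw [Measure.restrict_apply hOo.measurableSet] at h0
  exact hpos.ne' h0

/-- The sup over the closed cell of `|g|` is attained-bounded: `|g x| ≤ sSup (|g| '' closedCell)`. [folklore] -/
private theorem abs_le_sSup_closedCell {g : E3 → ℝ} (hg : Continuous g) {x : E3}
    (hx : x ∈ {x : E3 | cylRadius x ≤ R ∧ x 2 ∈ Icc (-a) a}) :
    |g x| ≤ sSup ((fun y => |g y|) '' {x : E3 | cylRadius x ≤ R ∧ x 2 ∈ Icc (-a) a}) :=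
  le_csSup ((isCompact_closedCell R a).bddAbove_image hg.abs.continuousOn) (mem_image_of_mem _ hx)

namespace IsSolution

/-- The velocity is smooth on `S × ℝ³` in the tree's sense. [folklore] -/
private theorem isSmoothSpaceTimeOn (hS : IsSolution R a ν T f v p ψ₁) (S : Set ℝ) : IsSmoothSpaceTimeOn S v :=
  hS.smooth_v.contDiffOn

/-- **The swirl equation in the cylinder** (the equation for `u = rv_φ` behind Lemma 2.3; KNSS 2009 (1.8)):
at interior points off the axis, `∂ₜu + v·∇u = ν(Δu − (2/r)∂_r u) + rf_φ`, from the momentum equation paired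
with the rotation generator `J x` (as in the tree's `swirl_transport_holds`, here with the force).
[cite: Zajaczkowski2023, Lemma 2.3 p.9 (equation for u); KNSS2009, (1.8)] -/
theorem swirl_eq (hS : IsSolution R a ν T f v p ψ₁) {t : ℝ} (ht : t ∈ Ico 0 T) {x : E3}
    (hx : x ∈ cylinder R) (hr : cylRadius x ≠ 0) :
    timeDerivWithin (Ico 0 T) (fun s => swirl (v s)) t x + convect (v t) (swirl (v t)) x =
      ν * ((Δ (swirl (v t))) x - 2 / cylRadius x * partialDeriv (eR x) (swirl (v t)) x) + swirl (f t) x := by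
  have hU2 : ContDiff ℝ 2 (v t) := (hS.contDiff_v t).of_le (by norm_cast)
  have hUd : DifferentiableAt ℝ (v t) x := (hU2.of_le one_le_two).differentiable one_ne_zero x
  have hPd : DifferentiableAt ℝ (p t) x :=
    (((hS.contDiff_p t).of_le (by exact_mod_cast le_top) : ContDiff ℝ 1 (p t)).differentiable
      one_ne_zero) x
  have hmom := congrArg (fun w : E3 => ⟪rotGen x, w⟫) (hS.ns.momentum t ht x hx)
  simp only [inner_add_right, inner_sub_right, inner_smul_right] at hmom
  rw [timeDerivWithin_swirl (hS.isSmoothSpaceTimeOn _) ht x, convect_swirl hUd, hmom,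
    laplacian_swirl hU2 x, (hS.axisym t).2.2.1.inner_rotGen_gradient hPd,
    (hS.axisym t).1.partialDeriv_eR_swirl hUd, swirl_eq_inner_rotGen (f t)]
  field_simp
  ring

end IsSolution

/-! ### §I.7 The axial barrier `M + c(1 + z²)` -/

/-- The height coordinate as a continuous linear form: `proj₂ y = y 2`. [folklore] -/
private theorem zCoord_apply (y : E3) : (EuclideanSpace.proj (2 : Fin 3) : E3 →L[ℝ] ℝ) y = y 2 := rfl

/-- Gradient of the axial barrier: `D(M + c(1 + z²))(x) = 2c z(x) dz`. [folklore] -/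
private theorem hasFDerivAt_axialBarrier (M c : ℝ) (x : E3) :
    HasFDerivAt (fun y : E3 => M + c * (1 + (y 2) ^ 2)) ((c * (2 * x 2)) • (EuclideanSpace.proj (2 : Fin 3) : E3 →L[ℝ] ℝ)) x := by
  have h1 : HasFDerivAt (fun y : E3 => (y 2) ^ 2) ((2 * x 2) • (EuclideanSpace.proj (2 : Fin 3) : E3 →L[ℝ] ℝ)) x := by
    have h := (EuclideanSpace.proj (2 : Fin 3) : E3 →L[ℝ] ℝ).hasFDerivAt.pow 2 (x := x)
    simpa [zCoord_apply] using h
  have h2 := ((h1.const_add 1).const_mul c).const_add M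
  exact h2.congr_fderiv (smul_smul _ _ _)

/-- The axial barrier is smooth. [folklore] -/
private theorem contDiff_axialBarrier (M c : ℝ) {n : WithTop ℕ∞} : ContDiff ℝ n (fun y : E3 => M + c * (1 + (y 2) ^ 2)) :=
  contDiff_const.add (contDiff_const.mul (contDiff_const.add ((EuclideanSpace.proj (2 : Fin 3) : E3 →L[ℝ] ℝ).contDiff.pow 2)))

/-- Laplacian of the axial barrier: `Δ(M + c(1 + z²)) = 2c`. [folklore] -/
private theorem laplacian_axialBarrier (M c : ℝ) (x : E3) :
    (Δ (fun y : E3 => (M + c * (1 + (y 2) ^ 2) : ℝ))) x = 2 * c := by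
  have hD : ∀ (y e : E3), fderiv ℝ (fun y : E3 => M + c * (1 + (y 2) ^ 2)) y e = c * (2 * y 2) * e 2 := by
    intro y e
    rw [(hasFDerivAt_axialBarrier M c y).fderiv, FunLike.coe_smul, Pi.smul_apply, zCoord_apply,
      smul_eq_mul]
  have e0 : ((EuclideanSpace.basisFun (Fin 3) ℝ) 0 : E3) 2 = 0 := by simp
  have e1 : ((EuclideanSpace.basisFun (Fin 3) ℝ) 1 : E3) 2 = 0 := by simp
  have e2 : ((EuclideanSpace.basisFun (Fin 3) ℝ) 2 : E3) 2 = 1 := by simp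
  have hf0 : (fun y : E3 => fderiv ℝ (fun y : E3 => M + c * (1 + (y 2) ^ 2)) y ((EuclideanSpace.basisFun (Fin 3) ℝ) 0)) = fun _ => (0 : ℝ) := by
    funext y; rw [hD, e0, mul_zero]
  have hf1 : (fun y : E3 => fderiv ℝ (fun y : E3 => M + c * (1 + (y 2) ^ 2)) y ((EuclideanSpace.basisFun (Fin 3) ℝ) 1)) = fun _ => (0 : ℝ) := by
    funext y; rw [hD, e1, mul_zero]
  have hf2 : (fun y : E3 => fderiv ℝ (fun y : E3 => M + c * (1 + (y 2) ^ 2)) y ((EuclideanSpace.basisFun (Fin 3) ℝ) 2)) =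
      fun y => (2 * c) * (EuclideanSpace.proj (2 : Fin 3) : E3 →L[ℝ] ℝ) y := by
    funext y; rw [hD, e2, mul_one, zCoord_apply]; ring
  rw [laplacian_eq_sum_fderiv_fderiv (EuclideanSpace.basisFun (Fin 3) ℝ) (contDiff_axialBarrier M c) x, Fin.sum_univ_three, hf0, hf1, hf2,
    fderiv_const_mul (EuclideanSpace.proj (2 : Fin 3) : E3 →L[ℝ] ℝ).differentiableAt, (EuclideanSpace.proj (2 : Fin 3) : E3 →L[ℝ] ℝ).fderiv]
  simp

end SwirlMax

/-! ### §I.8 Lemma 2.3: the maximum principle for `u = rv_φ` in the periodic slip cylinder -/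

section SwirlMax2

variable {R a ν T : ℝ} {f v : ℝ → E3 → E3} {p : ℝ → E3 → ℝ} {ψ₁ : ℝ → E3 → ℝ}

/-- A bound on the closed period cell of a `2a`-periodic function is a bound on the whole solid cylinder
`{r ≤ R}`. [folklore] -/
private theorem forall_abs_le_of_closedCell {g : E3 → ℝ} {a R C : ℝ} (ha : 0 < a) (hper : IsAxiallyPeriodic (2 * a) g)
    (h : ∀ x ∈ {x : E3 | cylRadius x ≤ R ∧ x 2 ∈ Icc (-a) a}, |g x| ≤ C) :
    ∀ x : E3, cylRadius x ≤ R → |g x| ≤ C := by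
  intro x hx
  obtain ⟨k, hk⟩ := exists_int_shift_mem_Icc ha x
  rw [← hper.add_int_mul k x]
  exact h _ ⟨by rw [cylRadius_add_smul_single_two]; exact hx, hk⟩

/-- The `z`-component of the radial unit vector vanishes. [folklore] -/
private theorem eR_apply_two (x : E3) : eR x 2 = 0 := by simp [eR]

/-- The origin-height point `0` lies in every closed cell with `R, a ≥ 0`. [folklore] -/
private theorem zero_mem_closedCell (hR : 0 ≤ R) (ha : 0 ≤ a) :
    (0 : E3) ∈ {x : E3 | cylRadius x ≤ R ∧ x 2 ∈ Icc (-a) a} := by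
  refine ⟨by simp [cylRadius]; exact hR, ?_⟩
  simp only [PiLp.zero_apply, mem_Icc]
  exact ⟨by linarith, ha⟩

namespace IsSolution

set_option maxHeartbeats 800000 in
/-- **Lemma 2.3 (2.7), real form — the maximum principle for the swirl `u = rv_φ`**: if `|u(0,·)| ≤ M₀` on
the solid cylinder, then for `s ∈ (0, T)` and every `x` with `r(x) ≤ R`,
`|u(s,x)| ≤ M₀ + ∫₀ˢ max_{Ω̄} |rf_φ(τ,·)| dτ`. Proof: the tree's weak parabolic maximum principle
(`weak_max_principle`) applied to `w = ±u − (M₀ + ∫₀ᵗ G + εe^{βt}(1 + z²))`, `β = 2ν + sup|v| + 1`, on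
`K = {r ≤ R, |z| ≤ Z}`, `U = {0 < r < R, |z| < Z}`: at an interior critical point the swirl equation
(`swirl_eq`; the singular drift `(2ν/r)∂_r` drops out because `∂_r(z²) = 0`) gives `wₜ < 0`; on the parabolic
boundary `w ≤ 0` because `u = 0` on the axis and on the wall (`v_φ|_{S₁} = 0`), `|u(0)| ≤ M₀`, and, for `Z`
large, the periodic (hence bounded) `u` is beaten by the barrier at `|z| = Z`; then `ε → 0`.
[cite: Zajaczkowski2023, Lemma 2.3 (2.7) p.9 l.50–52; Lieberman1996, Ch. II Lemma 2.1] -/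
theorem abs_swirl_le (hS : IsSolution R a ν T f v p ψ₁) {M₀ : ℝ}
    (hM₀ : ∀ x : E3, cylRadius x ≤ R → |swirl (v 0) x| ≤ M₀) {s : ℝ} (hs : s ∈ Ioo 0 T) :
    ∀ x : E3, cylRadius x ≤ R →
      |swirl (v s) x| ≤ M₀ + ∫ τ in (0 : ℝ)..s,
        sSup ((fun y => |swirl (f τ) y|) '' {y : E3 | cylRadius y ≤ R ∧ y 2 ∈ Icc (-a) a}) := by
  have hR := hS.R_pos
  have ha := hS.a_pos
  have hν := hS.ν_pos
  set S : Set ℝ := Ico 0 T with hS_def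
  set KF : Set E3 := {y : E3 | cylRadius y ≤ R ∧ y 2 ∈ Icc (-a) a} with hKF
  set G : ℝ → ℝ := fun τ => sSup ((fun y => |swirl (f τ) y|) '' KF) with hG
  -- continuity and bounds of the data
  have hswf : Continuous fun z : ℝ × E3 => swirl (f z.1) z.2 := by
    have h : (fun z : ℝ × E3 => swirl (f z.1) z.2) = fun z => ⟪rotGenL z.2, uncurry f z⟫ := by
      funext z; simp only [swirl_eq_inner_rotGen, rotGenL_apply, uncurry]
    rw [h]
    exact (rotGenL.continuous.comp continuous_snd).inner hS.smooth_f.continuous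
  have hswv : Continuous fun z : ℝ × E3 => swirl (v z.1) z.2 := by
    have h : (fun z : ℝ × E3 => swirl (v z.1) z.2) = fun z => ⟪rotGenL z.2, uncurry v z⟫ := by
      funext z; simp only [swirl_eq_inner_rotGen, rotGenL_apply, uncurry]
    rw [h]
    exact (rotGenL.continuous.comp continuous_snd).inner hS.smooth_v.continuous
  have hGc : Continuous G := by
    have h := (isCompact_closedCell R a).continuous_sSup (f := fun τ (y : E3) => |swirl (f τ) y|)
      (by exact hswf.abs)
    exact h
  have hGb : ∀ τ, ∀ x : E3, cylRadius x ≤ R → |swirl (f τ) x| ≤ G τ := fun τ =>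
    forall_abs_le_of_closedCell ha (isAxiallyPeriodic_swirl (hS.periodic τ).2.2.1)
      fun x hx => abs_le_sSup_closedCell (hswf.comp (Continuous.prodMk_right τ)) hx
  have hG0 : ∀ τ, 0 ≤ G τ := fun τ =>
    (abs_nonneg _).trans (hGb τ 0 (by simp [cylRadius]; exact hR.le))
  have hM₀0 : 0 ≤ M₀ := (abs_nonneg _).trans (hM₀ 0 (by simp [cylRadius]; exact hR.le))
  obtain ⟨V, hV0, hV⟩ := exists_bound_of_periodic ha hS.smooth_v.continuous (fun τ => (hS.periodic τ).1) s R
  obtain ⟨B, hB0, hB⟩ := exists_bound_of_periodic (g := fun τ x => swirl (v τ) x) ha hswv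
    (fun τ => isAxiallyPeriodic_swirl (hS.periodic τ).1) s R
  -- the time-dependent level `Mf τ = M₀ + ∫₀^τ G`
  set Mf : ℝ → ℝ := fun τ => M₀ + ∫ σ in (0 : ℝ)..τ, G σ with hMf
  have hMfd : ∀ τ, HasDerivAt Mf (G τ) τ := fun τ => by
    have h := ((hGc.integral_hasStrictDerivAt 0 τ).hasDerivAt).const_add M₀
    exact h
  have hMfc : Continuous Mf := continuous_iff_continuousAt.2 fun τ => (hMfd τ).continuousAt
  have hMf0 : ∀ τ, 0 ≤ τ → M₀ ≤ Mf τ := fun τ hτ => by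
    have : 0 ≤ ∫ σ in (0 : ℝ)..τ, G σ := intervalIntegral.integral_nonneg hτ fun σ _ => hG0 σ
    show M₀ ≤ M₀ + _
    linarith
  set β : ℝ := 2 * ν + V + 1 with hβ
  have hβ0 : 0 ≤ β := by rw [hβ]; positivity
  -- regularity of the velocity
  have hvC2 : ∀ τ, ContDiff ℝ 2 (v τ) := fun τ => (hS.contDiff_v τ).of_le (by norm_cast)
  have hvd : ∀ τ (x : E3), DifferentiableAt ℝ (v τ) x := fun τ x =>
    ((hvC2 τ).of_le one_le_two).differentiable one_ne_zero x
  have hsm : IsSmoothSpaceTimeOn S v := hS.isSmoothSpaceTimeOn S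
  -- the claim for every `ε > 0` and both signs
  suffices key : ∀ ε : ℝ, 0 < ε → ∀ x : E3, cylRadius x ≤ R → ∀ σ : ℝ, (σ = 1 ∨ σ = -1) →
      σ * swirl (v s) x ≤ Mf s + ε * Real.exp (β * s) * (1 + (x 2) ^ 2) by
    intro x hx
    have hboth : ∀ σ : ℝ, (σ = 1 ∨ σ = -1) → σ * swirl (v s) x ≤ Mf s := by
      intro σ hσ
      refine le_of_forall_pos_le_add fun η hη => ?_
      set C : ℝ := Real.exp (β * s) * (1 + (x 2) ^ 2) with hC
      have hCpos : 0 < C := by positivity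
      have h := key (η / C) (div_pos hη hCpos) x hx σ hσ
      have e : η / C * Real.exp (β * s) * (1 + (x 2) ^ 2) = η := by rw [hC]; field_simp
      rw [e] at h
      exact h
    have h1 := hboth 1 (Or.inl rfl)
    have h2 := hboth (-1) (Or.inr rfl)
    rw [one_mul] at h1
    rw [neg_one_mul] at h2
    exact abs_le.2 ⟨by linarith, h1⟩
  intro ε hε x₀ hx₀ σ hσ
  have hσabs : ∀ q : ℝ, σ * q ≤ |q| := fun q => by
    rcases hσ with h | h
    · rw [h, one_mul]; exact le_abs_self q
    · rw [h, neg_one_mul]; exact neg_le_abs q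
  -- the height cut-off `Z`
  set Z : ℝ := max |x₀ 2| (B / ε + 1) with hZ
  have hZ1 : 1 ≤ Z := le_trans (by have := div_nonneg hB0 hε.le; linarith) (le_max_right _ _)
  have hZB : B ≤ ε * (1 + Z ^ 2) := by
    have h1 : B / ε + 1 ≤ Z := le_max_right _ _
    have h2 : B / ε ≤ Z ^ 2 := by nlinarith
    rw [div_le_iff₀ hε] at h2
    nlinarith
  -- the comparison function
  set w : ℝ → E3 → ℝ := fun τ x =>
    σ * swirl (v τ) x - (Mf τ + ε * Real.exp (β * τ) * (1 + (x 2) ^ 2)) with hw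
  set Γₜ : ℝ → E3 → ℝ := fun τ x => timeDerivWithin S (fun s => swirl (v s)) τ x with hΓₜ
  set wₜ : ℝ → E3 → ℝ := fun τ x =>
    σ * Γₜ τ x - (G τ + β * (ε * Real.exp (β * τ) * (1 + (x 2) ^ 2))) with hwₜ
  set K : Set E3 := {x : E3 | cylRadius x ≤ R ∧ x 2 ∈ Icc (-Z) Z} with hK
  set U : Set E3 := {x : E3 | 0 < cylRadius x ∧ cylRadius x < R ∧ x 2 ∈ Ioo (-Z) Z} with hU
  have hKc : IsCompact K := isCompact_closedCell R Z
  have hUo : IsOpen U := by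
    refine (isOpen_lt continuous_const continuous_cylRadius).inter
      ((isOpen_lt continuous_cylRadius continuous_const).inter ?_)
    exact isOpen_Ioo.preimage (EuclideanSpace.proj (2 : Fin 3)).continuous
  have hUK : U ⊆ K := fun x hx => ⟨hx.2.1.le, Ioo_subset_Icc_self hx.2.2⟩
  -- (a) joint continuity
  have hc : ContinuousOn (uncurry w) (Icc 0 s ×ˢ K) := by
    have h2 : Continuous fun z : ℝ × E3 => Mf z.1 + ε * Real.exp (β * z.1) * (1 + (z.2 2) ^ 2) := by
      have : Continuous fun z : ℝ × E3 => z.2 2 := (EuclideanSpace.proj (2 : Fin 3)).continuous.comp continuous_snd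
      fun_prop
    exact ((continuous_const.mul hswv).sub h2).continuousOn
  -- (b) smooth slices
  have h2 : ∀ τ ∈ Ioc 0 s, ContDiff ℝ 2 (w τ) := fun τ _ =>
    (contDiff_const.mul (contDiff_swirl (hvC2 τ))).sub (contDiff_axialBarrier (Mf τ) (ε * Real.exp (β * τ)))
  -- (c) the left time derivative
  have ht : ∀ τ ∈ Ioc 0 s, ∀ x ∈ U, HasDerivWithinAt (fun s' => w s' x) (wₜ τ x) (Icc 0 τ) τ := by
    intro τ hτ x _
    have hτS : τ ∈ S := ⟨hτ.1.le, hτ.2.trans_lt hs.2⟩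
    have hΓ : HasDerivWithinAt (fun s' => swirl (v s') x) (Γₜ τ x) S τ := by
      have hd : DifferentiableWithinAt ℝ (fun s' => swirl (v s') x) S τ := by
        have h1 := hsm.differentiableWithinAt_time hτS x
        simp only [swirl_eq_inner_rotGen]
        exact (differentiableWithinAt_const _).inner ℝ h1
      have := hd.hasDerivWithinAt
      simp only [hΓₜ, timeDerivWithin_apply]
      exact this
    have hexp : HasDerivAt (fun s' => Mf s' + ε * Real.exp (β * s') * (1 + (x 2) ^ 2))
        (G τ + ε * (Real.exp (β * τ) * β) * (1 + (x 2) ^ 2)) τ := by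
      have h1 : HasDerivAt (fun s' => Real.exp (β * s')) (Real.exp (β * τ) * β) τ := by
        have := ((hasDerivAt_id τ).const_mul β).exp
        simpa using this
      exact (hMfd τ).add ((h1.const_mul ε).mul_const (1 + (x 2) ^ 2))
    have h := ((hΓ.const_mul σ).sub hexp.hasDerivWithinAt).mono
      (show Icc 0 τ ⊆ S from fun s' hs' => ⟨hs'.1, hs'.2.trans_lt (hτ.2.trans_lt hs.2)⟩)
    simp only [hw, hwₜ]
    exact h.congr_deriv (by ring)
  -- (d) the sub-solution implication, from the swirl equation
  have hsub : ∀ τ ∈ Ioc 0 s, ∀ x ∈ U, fderiv ℝ (w τ) x = 0 → (Δ (w τ)) x ≤ 0 → wₜ τ x ≤ 0 := by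
    intro τ hτ x hx hgrad hlap
    have hτS : τ ∈ S := ⟨hτ.1.le, hτ.2.trans_lt hs.2⟩
    have hτI : τ ∈ Icc 0 s := ⟨hτ.1.le, hτ.2⟩
    obtain ⟨hr0, hrR, hz⟩ := hx
    have hr : cylRadius x ≠ 0 := hr0.ne'
    have hxC : x ∈ cylinder R := hrR
    set c : ℝ := ε * Real.exp (β * τ) with hc
    have hc0 : 0 < c := by positivity
    -- the swirl equation at `(τ, x)`
    have hpde := hS.swirl_eq hτS hxC hr
    rw [convect_apply, partialDeriv_apply] at hpde
    -- derivatives of the two parts of `w τ`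
    have hΓd : DifferentiableAt ℝ (swirl (v τ)) x := differentiableAt_swirl (hvd τ x)
    have hBar := hasFDerivAt_axialBarrier (Mf τ) c x
    have hwderiv : HasFDerivAt (w τ) (σ • fderiv ℝ (swirl (v τ)) x -
        (c * (2 * x 2)) • (EuclideanSpace.proj (2 : Fin 3) : E3 →L[ℝ] ℝ)) x := by
      have h := (hΓd.hasFDerivAt.const_mul σ).sub hBar
      simp only [hw, hc]
      exact h
    have hDeq : σ • fderiv ℝ (swirl (v τ)) x = (c * (2 * x 2)) • (EuclideanSpace.proj (2 : Fin 3) : E3 →L[ℝ] ℝ) := by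
      have := hwderiv.fderiv
      rw [hgrad] at this
      exact (sub_eq_zero.1 this.symm)
    have hDapply : ∀ e : E3, σ * fderiv ℝ (swirl (v τ)) x e = c * (2 * x 2) * e 2 := fun e => by
      have := congrArg (fun L : E3 →L[ℝ] ℝ => L e) hDeq
      simpa [zCoord_apply] using this
    -- Laplacians
    have hΔeq : (Δ (w τ)) x = σ * (Δ (swirl (v τ))) x - 2 * c := by
      have h1 : ContDiffAt ℝ 2 (fun y => σ * swirl (v τ) y) x :=
        (contDiff_const.mul (contDiff_swirl (hvC2 τ))).contDiffAt
      have h2 : ContDiffAt ℝ 2 (fun y : E3 => (Mf τ + c * (1 + (y 2) ^ 2) : ℝ)) x :=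
        (contDiff_axialBarrier (Mf τ) c).contDiffAt
      have h3 : (Δ (fun y => σ * swirl (v τ) y)) x = σ * (Δ (swirl (v τ))) x := by
        have : (fun y => σ * swirl (v τ) y) = σ • swirl (v τ) := by
          funext y; simp [smul_eq_mul]
        rw [this, laplacian_smul σ ((contDiff_swirl (hvC2 τ)).contDiffAt), smul_eq_mul]
      have h4 := h1.laplacian_sub h2
      have hfun : w τ = (fun y => σ * swirl (v τ) y) - fun y : E3 => (Mf τ + c * (1 + (y 2) ^ 2) : ℝ) := by
        funext y
        simp only [hw, hc, Pi.sub_apply]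
      rw [hfun, h4, h3, laplacian_axialBarrier]
    have hΔ : σ * (Δ (swirl (v τ))) x ≤ 2 * c := by
      rw [hΔeq] at hlap; linarith
    -- `σ Γₜ ≤ 2νc + 2c|z|V + G`
    have hΓeq : Γₜ τ x = ν * ((Δ (swirl (v τ))) x - 2 / cylRadius x * fderiv ℝ (swirl (v τ)) x (eR x)) +
        swirl (f τ) x - fderiv ℝ (swirl (v τ)) x (v τ x) := by
      have := eq_sub_of_add_eq hpde
      simpa [hΓₜ] using this
    have hvz : |v τ x 2| ≤ V := by
      have hsum : (v τ x 2) ^ 2 ≤ ∑ i : Fin 3, ‖v τ x i‖ ^ 2 := by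
        have := Finset.single_le_sum (f := fun i : Fin 3 => ‖v τ x i‖ ^ 2) (fun i _ => sq_nonneg _)
          (Finset.mem_univ (2 : Fin 3))
        simpa [Real.norm_eq_abs, sq_abs] using this
      have h1 : |v τ x 2| ≤ ‖v τ x‖ := by
        rw [EuclideanSpace.norm_eq]
        exact Real.abs_le_sqrt hsum
      exact h1.trans (hV τ hτI x hrR.le)
    have hΓt : σ * Γₜ τ x ≤ ν * (2 * c) + c * (2 * (|x 2| * V)) + G τ := by
      have e : σ * Γₜ τ x = ν * (σ * (Δ (swirl (v τ))) x) -
          ν * (2 / cylRadius x) * (σ * fderiv ℝ (swirl (v τ)) x (eR x)) +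
          σ * swirl (f τ) x - σ * fderiv ℝ (swirl (v τ)) x (v τ x) := by
        rw [hΓeq]; ring
      rw [e, hDapply (eR x), hDapply (v τ x), eR_apply_two]
      have h1 : ν * (σ * (Δ (swirl (v τ))) x) ≤ ν * (2 * c) := mul_le_mul_of_nonneg_left hΔ hν.le
      have h2 : σ * swirl (f τ) x ≤ G τ := (hσabs _).trans (hGb τ x hrR.le)
      have h3 : -(c * (2 * x 2) * v τ x 2) ≤ c * (2 * (|x 2| * V)) := by
        have h4 : |x 2 * v τ x 2| ≤ |x 2| * V := by
          rw [abs_mul]; exact mul_le_mul_of_nonneg_left hvz (abs_nonneg _)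
        have h5 := (abs_le.1 h4).1
        nlinarith
      nlinarith
    -- conclude: `wₜ ≤ (2ν + V − β) c (1 + z²) ≤ 0`
    set A : ℝ := c * (1 + (x 2) ^ 2) with hA
    have hA0 : 0 < A := by positivity
    have hx2 : 2 * (|x 2| * V) ≤ V * (1 + (x 2) ^ 2) := by
      nlinarith [sq_nonneg (|x 2| - 1), abs_nonneg (x 2), sq_abs (x 2)]
    have hx2' : c * (2 * (|x 2| * V)) ≤ V * A := by
      calc c * (2 * (|x 2| * V)) ≤ c * (V * (1 + (x 2) ^ 2)) := mul_le_mul_of_nonneg_left hx2 hc0.le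
        _ = V * A := by rw [hA]; ring
    have h6 : ν * (2 * c) ≤ 2 * ν * A := by
      have hpos : 0 ≤ ν * c * (x 2) ^ 2 := by positivity
      have e : 2 * ν * A - ν * (2 * c) = 2 * (ν * c * (x 2) ^ 2) := by rw [hA]; ring
      linarith
    have e2 : β * A = 2 * ν * A + V * A + A := by rw [hβ]; ring
    have e3 : wₜ τ x = σ * Γₜ τ x - (G τ + β * A) := rfl
    rw [e3]
    linarith
  -- (e) the parabolic boundary: `τ = 0`
  have hbot : ∀ x ∈ K, w 0 x ≤ 0 := by
    intro x hx
    have hMf00 : Mf 0 = M₀ := by simp [hMf]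
    simp only [hw, hMf00, mul_zero, Real.exp_zero, mul_one]
    have h1 := hσabs (swirl (v 0) x)
    have h2 := hM₀ x hx.1
    have h3 : 0 ≤ ε * (1 + (x 2) ^ 2) := by positivity
    linarith
  -- (f) the parabolic boundary: the axis, the wall and the caps `|z| = Z`
  have hlat : ∀ τ ∈ Icc 0 s, ∀ x ∈ K \ U, w τ x ≤ 0 := by
    intro τ hτ x hx
    obtain ⟨⟨hrR, hzZ⟩, hnU⟩ := hx
    have hτS : τ ∈ S := ⟨hτ.1, hτ.2.trans_lt hs.2⟩
    have hMfτ : M₀ ≤ Mf τ := hMf0 τ hτ.1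
    have hexp1 : 1 ≤ Real.exp (β * τ) := Real.one_le_exp (mul_nonneg hβ0 hτ.1)
    have hbar0 : 0 ≤ ε * Real.exp (β * τ) * (1 + (x 2) ^ 2) := by positivity
    simp only [hw]
    by_cases hax : cylRadius x = 0
    · rw [swirl_eq_zero_of_cylRadius_eq_zero (v τ) hax, mul_zero]
      linarith
    by_cases hwall : cylRadius x = R
    · have hsv : swirlVelocity (v τ) x = 0 := (hS.wall τ hτS x hwall).2.1
      rw [swirl_eq_cylRadius_mul_swirlVelocity (v τ) hax, hsv, mul_zero, mul_zero]
      linarith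
    · -- the caps: `|x 2| = Z`
      have hr0 : 0 < cylRadius x := (cylRadius_nonneg x).lt_of_ne' hax
      have hrR' : cylRadius x < R := hrR.lt_of_ne hwall
      have hzcap : (x 2) ^ 2 = Z ^ 2 := by
        have hnot : x 2 ∉ Ioo (-Z) Z := fun h => hnU ⟨hr0, hrR', h⟩
        rcases hzZ.1.lt_or_eq with h1 | h1
        · rcases hzZ.2.lt_or_eq with h2 | h2
          · exact absurd ⟨h1, h2⟩ hnot
          · rw [h2]
        · rw [← h1]; ring
      have h1 : σ * swirl (v τ) x ≤ B := by
        refine (hσabs _).trans ?_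
        have := hB τ hτ x hrR
        rwa [Real.norm_eq_abs] at this
      have hH : ε * (1 + Z ^ 2) ≤ ε * Real.exp (β * τ) * (1 + (x 2) ^ 2) := by
        rw [hzcap]
        have : ε * (1 + Z ^ 2) * 1 ≤ ε * (1 + Z ^ 2) * Real.exp (β * τ) :=
          mul_le_mul_of_nonneg_left hexp1 (by positivity)
        linarith
      linarith
  -- the maximum principle, evaluated at `(s, x₀)`
  have hx₀K : x₀ ∈ K := ⟨hx₀, abs_le.1 (le_max_left _ _)⟩
  have key := weak_max_principle hKc hUo hUK hc h2 ht hsub hbot hlat s ⟨hs.1.le, le_rfl⟩ x₀ hx₀K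
  simp only [hw] at key
  linarith

end IsSolution

end SwirlMax2

/-! ### §I.9 Lemma 2.3 as typed and the discharge of Step 1 -/

section Final

variable {R a ν T : ℝ} {f v : ℝ → E3 → E3} {p : ℝ → E3 → ℝ} {ψ₁ : ℝ → E3 → ℝ}

/-- A continuous function on the cell is a.e. bounded by the real part of its (finite) `L^∞(Ω)` norm, and
hence (closure argument + periodicity) bounded by it on the whole solid cylinder `{r ≤ R}`. [folklore] -/
private theorem forall_abs_le_toReal_Lp_top (hR : 0 < R) (ha : 0 < a) {g : E3 → ℝ} (hg : Continuous g)
    (hper : IsAxiallyPeriodic (2 * a) g) :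
    ∀ x : E3, cylRadius x ≤ R → |g x| ≤ (Lp R a ∞ g).toReal := by
  have hmem : MemLp g ∞ (volume.restrict (cell R a)) := memLp_cell_of_continuous hg ∞
  have htop : Lp R a ∞ g ≠ ⊤ := by
    rw [Lp, μΩ]
    exact hmem.eLpNorm_lt_top.ne
  have hae : ∀ᵐ y ∂(volume.restrict (cell R a)), |g y| ≤ (Lp R a ∞ g).toReal := by
    have h := enorm_ae_le_eLpNormEssSup g (volume.restrict (cell R a))
    refine h.mono fun y hy => ?_
    rw [Real.enorm_eq_ofReal_abs] at hy
    rw [Lp, μΩ, eLpNorm_exponent_top]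
    rw [Lp, μΩ, eLpNorm_exponent_top] at htop
    exact (ENNReal.ofReal_le_iff_le_toReal htop).1 hy
  refine forall_abs_le_of_closedCell ha hper fun x hx => ?_
  exact le_of_ae_le_of_mem_closure (isOpen_cell R a) hg.abs hae (closedCell_subset_closure_cell hR ha hx)

namespace IsSolution

/-- **Lemma 2.3, inequality (2.7) as typed** (second conjunct of `Ineq21_27`):
`‖rv_φ(s)‖_{L_∞(Ω)} ≤ ‖rf_φ‖_{L_{∞,1}(Ω^t)} + ‖rv_φ(0)‖_{L_∞(Ω)} = D₂`. [cite: Zajaczkowski2023, Lemma 2.3 (2.7) p.9 l.50–52] -/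
theorem ineq27 (hS : IsSolution R a ν T f v p ψ₁) {t : ℝ} (ht : t ∈ Ioc 0 T) {s : ℝ} (hs : s ∈ Ioo 0 t) :
    Lp R a ∞ (swirl (v s)) ≤ D2 R a t f v := by
  have hR := hS.R_pos
  have ha := hS.a_pos
  have hsT : s ∈ Ioo 0 T := ⟨hs.1, hs.2.trans_le ht.2⟩
  -- the datum
  set m : ℝ≥0∞ := Lp R a ∞ (swirl (v 0)) with hm
  have hswc : ∀ τ (w : ℝ → E3 → E3), Continuous (uncurry w) → Continuous (swirl (w τ)) := fun τ w hw => by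
    rw [swirl_eq_inner_rotGen]
    exact rotGenL.continuous.inner (hw.comp (Continuous.prodMk_right τ))
  have hM₀ : ∀ x : E3, cylRadius x ≤ R → |swirl (v 0) x| ≤ m.toReal :=
    forall_abs_le_toReal_Lp_top hR ha (hswc 0 v hS.smooth_v.continuous) (isAxiallyPeriodic_swirl (hS.periodic 0).1)
  have hmtop : m ≠ ⊤ := by
    rw [hm, Lp, μΩ]
    exact (memLp_cell_of_continuous (hswc 0 v hS.smooth_v.continuous) ∞).eLpNorm_lt_top.ne
  -- the force: `G τ = max_{Ω̄} |rf_φ(τ)|` is continuous, nonnegative, and below the `L^∞(Ω)` norm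
  set KF : Set E3 := {y : E3 | cylRadius y ≤ R ∧ y 2 ∈ Icc (-a) a} with hKF
  set G : ℝ → ℝ := fun τ => sSup ((fun y => |swirl (f τ) y|) '' KF) with hG
  have hswf : Continuous fun z : ℝ × E3 => swirl (f z.1) z.2 := by
    have h : (fun z : ℝ × E3 => swirl (f z.1) z.2) = fun z => ⟪rotGenL z.2, uncurry f z⟫ := by
      funext z; simp only [swirl_eq_inner_rotGen, rotGenL_apply, uncurry]
    rw [h]
    exact (rotGenL.continuous.comp continuous_snd).inner hS.smooth_f.continuous
  have hGc : Continuous G := by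
    have h := (isCompact_closedCell R a).continuous_sSup (f := fun τ (y : E3) => |swirl (f τ) y|)
      (by exact hswf.abs)
    exact h
  have hG0 : ∀ τ, 0 ≤ G τ := fun τ =>
    (abs_nonneg _).trans (abs_le_sSup_closedCell (hswf.comp (Continuous.prodMk_right τ))
      (zero_mem_closedCell hR.le ha.le))
  have hGle : ∀ τ, ENNReal.ofReal (G τ) ≤ Lp R a ∞ (swirl (f τ)) := by
    intro τ
    have hcont : Continuous (swirl (f τ)) := hswc τ f hS.smooth_f.continuous
    have htop : Lp R a ∞ (swirl (f τ)) ≠ ⊤ := by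
      rw [Lp, μΩ]
      exact (memLp_cell_of_continuous hcont ∞).eLpNorm_lt_top.ne
    rw [← ENNReal.ofReal_toReal htop]
    refine ENNReal.ofReal_le_ofReal ?_
    refine csSup_le ((Set.image_nonempty).2 ⟨0, zero_mem_closedCell hR.le ha.le⟩) ?_
    rintro _ ⟨y, hy, rfl⟩
    exact forall_abs_le_toReal_Lp_top hR ha hcont (isAxiallyPeriodic_swirl (hS.periodic τ).2.2.1) y hy.1
  -- the real bound on the cell
  have hreal := hS.abs_swirl_le hM₀ hsT
  have hLHS : Lp R a ∞ (swirl (v s)) ≤ ENNReal.ofReal (m.toReal + ∫ τ in (0 : ℝ)..s, G τ) := by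
    rw [Lp, μΩ, eLpNorm_exponent_top]
    refine eLpNormEssSup_le_of_ae_bound (ae_restrict_of_forall_mem (measurableSet_cell R a) fun x hx => ?_)
    rw [Real.norm_eq_abs]
    exact hreal x hx.1.le
  have hI0 : 0 ≤ ∫ τ in (0 : ℝ)..s, G τ := intervalIntegral.integral_nonneg hs.1.le fun τ _ => hG0 τ
  have hIst : ∫ τ in (0 : ℝ)..s, G τ ≤ ∫ τ in (0 : ℝ)..t, G τ :=
    intervalIntegral.integral_mono_interval le_rfl hs.1.le hs.2.le
      (Eventually.of_forall fun τ => hG0 τ) (hGc.intervalIntegrable _ _)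
  have hforce : ENNReal.ofReal (∫ τ in (0 : ℝ)..t, G τ) ≤ Lpq R a ∞ 1 t (fun τ => swirl (f τ)) := by
    rw [Lpq]
    simp only [ENNReal.rpow_one, div_one]
    rw [intervalIntegral.integral_of_le ht.1.le, integral_Ioc_eq_integral_Ioo,
      ofReal_integral_eq_lintegral_ofReal (hGc.integrableOn_Icc.mono_set Ioo_subset_Icc_self)
        (Eventually.of_forall fun τ => hG0 τ)]
    exact lintegral_mono fun τ => hGle τ
  calc Lp R a ∞ (swirl (v s)) ≤ ENNReal.ofReal (m.toReal + ∫ τ in (0 : ℝ)..s, G τ) := hLHS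
    _ = m + ENNReal.ofReal (∫ τ in (0 : ℝ)..s, G τ) := by
        rw [ENNReal.ofReal_add ENNReal.toReal_nonneg hI0, ENNReal.ofReal_toReal hmtop]
    _ ≤ m + ENNReal.ofReal (∫ τ in (0 : ℝ)..t, G τ) := by
        gcongr
    _ ≤ m + Lpq R a ∞ 1 t (fun τ => swirl (f τ)) := by gcongr
    _ = D2 R a t f v := by rw [D2, hm, add_comm]

end IsSolution

/-- **Step 1 of the printed plan (Lemmas 2.2 and 2.3) is TRUE**: along every solution of the setting the
energy inequality (2.1) and the maximum principle (2.7) for the swirl hold on every `Ω^t`, `0 < t ≤ T`.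
Discharges the binder `h1` of `claim_of_steps` / `claimAxis_of_steps` (D-0026: theorems only, no new facts).
[cite: Zajaczkowski2023, plan item 1 p.6 l.33–34; Lemma 2.2 (2.1) p.8 l.34–68; Lemma 2.3 (2.7) p.9 l.50–52] -/
theorem step1_L22_L23_holds : Step1_L22_L23 := by
  intro R a ν T f v p ψ₁ hS t ht
  exact ⟨fun s hs => hS.ineq21 ht hs, fun s hs => hS.ineq27 ht hs⟩

/-- **The printed composition with Step 1 AND Remark 4.8 discharged**: items 3, 3′, 4, 5 ⇒ Theorem 1.2 (1.24).
[cite: Zajaczkowski2023, proof plan p.6 l.32 – p.7 l.10; Remark 4.8 p.33 l.42] -/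
theorem claim_of_steps'' (h3 : Step3_PlanItem3) (h33 : Step_L33) (h4 : Step4_Sec4) (h5 : Step5_L47) :
    ClaimedTheorem :=
  claim_of_steps step1_L22_L23_holds h3 h33 h4 h5 step6_R48_holds

/-- **The charitable composition with Step 1 and Remark 4.8 discharged**: items 3′, 4, 5 ⇒ (1.24) on the
axis-vanishing class. [cite: Zajaczkowski2023, Remark 3.4 p.18 l.53–55; Remark 4.8 p.33 l.42] -/
theorem claimAxis_of_steps'' (h33 : Step_L33) (h4 : Step4_Sec4) (h5 : Step5_L47) : ClaimedTheoremAxis :=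
  claimAxis_of_steps step1_L22_L23_holds h33 h4 h5 step6_R48_holds

end Final

end Literature.Claims.NS.Zajaczkowski2023

end

-- WHAT THIS IS NOT: not a claim about NS regularity or blow-up; not a claim about any author beyond the typed
-- locator.
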